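import Mathlib.NumberTheory.SmoothNumbers
import Mathlib.NumberTheory.Harmonic.Bounds
import Literature.NumberTheory.Sieve.AsymptoticSieveForPrimesTyz
import Literature.NumberTheory.Sieve.AsymptoticSieveForPrimesRoughMoebius
import Literature.NumberTheory.Sieve.AsymptoticSieveForPrimesComparison
import Literature.NumberTheory.LFunctions.PrimeNumberTheoremErrorTerm
import Literature.NumberTheory.LFunctions.MoebiusHarmonicSumBound
import Literature.NumberTheory.LFunctions.MertensSecondLogPower
import HarnessLib

/-!
# Friedlander–Iwaniec's Möbius–density cancellation (2.4): the proof

Topic `Literature/NumberTheory/Sieve` (trunk T-SIEVE). Everything in this file is PROVED; the main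
result `Literature.NumberTheory.Sieve.fi_moebius_density_cancellation_holds` discharges the named fact
`Literature.NumberTheory.Sieve.fi_moebius_density_cancellation` (`AsymptoticSieveForPrimesInputs.lean`), i.e.
Friedlander–Iwaniec, *Asymptotic sieve for primes*, (2.4)–(2.5):

  under (1.8) `0 ≤ g(p) < 1`, `g(p) ≪ 1/p` and (1.9) `∑_{p ≤ y} g(p) = log log y + c + O((log y)^{-10})`,
  `∑_{d ≤ y, (d, ν) = 1} μ(d) g(d) ≪ σ_ν (log y)^{-6}` uniformly in `ν ≥ 1`, `y ≥ 2`,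
  `σ_ν = ∏_{p ∣ ν} (1 + p^{-1/2})`.

This is one of the two prime-number-theorem-strength inputs of FI's Theorem 1 (the other being
(1.13)–(1.14)); with it, `fi_asp_Tyz_estimate` and `fi_asp_T_estimate` of the tree become
unconditional (`AsymptoticSieveForPrimesTyz`, `…T`).

## The argument (FI pp. 1048–1049, every constant explicit)

Write `G_ν(y)` for the sum, `N = ⌈z⌉`, `P = P(z) = ∏_{p<N} p`, `t = log y`.
1. *Splitting* (`FIComparison.sum_eq_sum_smooth_mul_sum_coprime`): `G_ν(y) = ∑_{m ≤ y smooth}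
   A(m) G_ν(y/m, z)`, `A(m) = μ(m)g(m)[(m,ν)=1]`, `G_ν(w, z) = ∑_{n ≤ w, (n, νP)=1} μ(n) g(n)`.
2. *Smooth tail* `m > √y` (Rankin, `sum_divisors_tail_le`): `|G_ν(w,z)| ≤ ∑♭ g ≪ log y` and
   `∑_{m ∣ P, m > √y} g(m) ≤ y^{-1/log N} ∏_{p<N}(1 + 8 g(p))`.
3. *Comparison* for `m ≤ √y` (`FIComparison.abs_sum_moebius_mul_sub_le` with `a = 1/n`,
   `b = g·[(·,ν)=1]`): `|G_ν(w,z) - F(w,z)| ≤ h (∑♭_{n≤w} 1/n)(∑♭_{n ≤ w} g(n))` with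
   `h = 2(|K_f| + |K₂|)/(log(N-1))^{10} + K₁ σ_ν/√N` (`abs_sum_primes_Icc_sub_le` from (1.9) for `g`
   and the PROVED (1.9) for `1/p`, `Literature.NumberTheory.LFunctions.Mertens.exists_sum_primesLE_inv_loglog`;
   `sum_primeFactors_inv_le_sigmaHalf_div_sqrt`), and `F(w, z) = ∑_{n ≤ w, (n,P)=1} μ(n)/n` is bounded
   by `MoebiusRough.abs_sum_coprime_moebius_div_le` (from the PROVED `∑_{k≤x} μ(k)/k ≪ e^{-c√log x}`,
   `Literature.NumberTheory.LFunctions.abs_sum_moebius_div_le_exp_neg_sqrt_log`, replacing FI's contour integration).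
4. *Bookkeeping* (`abs_sum_coprime_moebius_density_le` = the structural bound; `numerics`): with
   `log z = t/(log t)²` and `log t ≥ 9` every term is `≪ σ_ν t^{-6}`; small `y` are trivial.

## References

* J. Friedlander, H. Iwaniec, *Asymptotic sieve for primes*, Ann. of Math. 148 (1998),
  1041–1065, §2, (2.4)–(2.5) and pp. 1048–1049. [FriedlanderIwaniecASP1998]
* G. Harman, *Prime-Detecting Sieves*, Princeton 2007, §12.9, (12.9.20)–(12.9.21). [Harman2007]

## Mathlib / tree

Tree inputs: `AsymptoticSieveForPrimesComparison`, `…RoughMoebius`, `MoebiusHarmonicSumBound`,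
`MertensSecondLogPower`, `PrimeNumberTheoremErrorTerm` (`pow_mul_pow_div_factorial_le_exp_sqrt`),
`AsymptoticSieveForPrimesTyz` (`sum_primesLE_density_le`, `IsMultiplicative.nonneg_of_squarefree`),
`AsymptoticSieveForPrimesReduction` (`sum_squarefree_prod_primeFactors_le`, `prod_one_add_le_exp_sum`),
`sigmaHalf`/`one_le_sigmaHalf` (`…Inputs`). Mathlib: `Nat.smoothNumbers`, `harmonic_le_one_add_log`,
`Real.log_le_rpow_div`, `IsMultiplicative.prodPrimeFactors_one_add_of_squarefree`.
-/

noncomputable section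

open Finset Real
open scoped ArithmeticFunction.Moebius ArithmeticFunction.zeta

namespace Literature.NumberTheory.Sieve

namespace FICancellation

/-! ### Sums of the density over squarefree numbers and over the divisors of `P(z)` -/

variable {g : ArithmeticFunction ℝ} {c₁ K₂ : ℝ}

/-- `∑_{d ≤ X sqfree} g(d) ≤ K₃ log X` for `X ≥ 2`, `K₃ = exp(|c₁| + |K₂|/(log 2)^{10})`, from (1.8)
(nonnegativity) and (1.9) (FI: "`∑♭_{n ≤ √y} g(n) ≤ ∏_{p ≤ √y}(1 + g(p)) ≪ log y`", p. 1048).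
[cite: FriedlanderIwaniecASP1998, §2 p. 1048] -/
theorem sum_squarefree_density_le (hg : g.IsMultiplicative) (hg0 : ∀ p : ℕ, p.Prime → 0 ≤ g p)
    (h19 : ∀ y : ℝ, 2 ≤ y →
      |(∑ p ∈ Nat.primesLE ⌊y⌋₊, g p) - (Real.log (Real.log y) + c₁)| ≤ K₂ / Real.log y ^ 10)
    {X : ℕ} (hX : 2 ≤ X) :
    ∑ d ∈ (Icc 1 X).filter Squarefree, g d ≤
      Real.exp (|c₁| + |K₂| / Real.log 2 ^ 10) * Real.log X := by
  have hX2 : (2 : ℝ) ≤ X := by exact_mod_cast hX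
  have hlogX : 0 < Real.log X := Real.log_pos (by linarith)
  calc ∑ d ∈ (Icc 1 X).filter Squarefree, g d
      = ∑ d ∈ (Icc 1 X).filter Squarefree, ∏ p ∈ d.primeFactors, g p := by
        refine Finset.sum_congr rfl fun d hd => ?_
        rw [hg.prod_primeFactors (Finset.mem_filter.mp hd).2]
    _ ≤ ∏ p ∈ Nat.primesLE X, (1 + g p) := sum_squarefree_prod_primeFactors_le hg0 X
    _ ≤ Real.exp (∑ p ∈ Nat.primesLE X, g p) :=
        prod_one_add_le_exp_sum _ fun p hp => hg0 p (Nat.prime_of_mem_primesLE hp)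
    _ ≤ Real.exp (Real.log (Real.log X) + |c₁| + |K₂| / Real.log 2 ^ 10) :=
        Real.exp_le_exp.mpr (sum_primesLE_density_le h19 hX)
    _ = Real.exp (|c₁| + |K₂| / Real.log 2 ^ 10) * Real.log X := by
        rw [add_assoc, Real.exp_add, Real.exp_log hlogX, mul_comm]

/-- `∑_{p < N} g(p) ≤ log log N + |c₁| + |K₂|/(log 2)^{10}` for `N ≥ 3`. [cite: FriedlanderIwaniecASP1998, (1.9)] -/
theorem sum_primesBelow_density_le
    (h19 : ∀ y : ℝ, 2 ≤ y →
      |(∑ p ∈ Nat.primesLE ⌊y⌋₊, g p) - (Real.log (Real.log y) + c₁)| ≤ K₂ / Real.log y ^ 10)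
    {N : ℕ} (hN : 3 ≤ N) :
    ∑ p ∈ N.primesBelow, g p ≤ Real.log (Real.log N) + |c₁| + |K₂| / Real.log 2 ^ 10 := by
  rw [Nat.primesBelow_eq_primesLE_sub_one]
  have h := sum_primesLE_density_le h19 (X := N - 1) (by omega)
  have hcast : ((N - 1 : ℕ) : ℝ) = (N : ℝ) - 1 := by rw [Nat.cast_sub (by omega)]; norm_num
  have hN3 : (3 : ℝ) ≤ N := by exact_mod_cast hN
  have hmono : Real.log (Real.log ((N - 1 : ℕ) : ℝ)) ≤ Real.log (Real.log N) := by
    rw [hcast]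
    have h1 : 1 < (N : ℝ) - 1 := by linarith
    exact Real.log_le_log (Real.log_pos h1) (Real.log_le_log (by linarith) (by linarith))
  linarith

/-- `∏_{p < N} (1 + t g(p)) ≤ (K₃^t) (log N)^t`-type bound: for `t ≥ 0` and `N ≥ 3`,
`∏_{p < N} (1 + t g(p)) ≤ exp(t (log log N + |c₁| + |K₂|/(log 2)^{10}))`. [folklore] -/
theorem prod_primesBelow_one_add_mul_density_le (hg0 : ∀ p : ℕ, p.Prime → 0 ≤ g p)
    (h19 : ∀ y : ℝ, 2 ≤ y →
      |(∑ p ∈ Nat.primesLE ⌊y⌋₊, g p) - (Real.log (Real.log y) + c₁)| ≤ K₂ / Real.log y ^ 10)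
    {t : ℝ} (ht : 0 ≤ t) {N : ℕ} (hN : 3 ≤ N) :
    ∏ p ∈ N.primesBelow, (1 + t * g p) ≤
      Real.exp (t * (Real.log (Real.log N) + |c₁| + |K₂| / Real.log 2 ^ 10)) := by
  calc ∏ p ∈ N.primesBelow, (1 + t * g p)
      ≤ Real.exp (∑ p ∈ N.primesBelow, t * g p) :=
        prod_one_add_le_exp_sum _ fun p hp => mul_nonneg ht (hg0 p (Nat.prime_of_mem_primesBelow hp))
    _ ≤ Real.exp (t * (Real.log (Real.log N) + |c₁| + |K₂| / Real.log 2 ^ 10)) := by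
        rw [← Finset.mul_sum]
        exact Real.exp_le_exp.mpr (mul_le_mul_of_nonneg_left (sum_primesBelow_density_le h19 hN) ht)

/-- The divisor sum of a multiplicative function over `P = ∏_{p<N} p`:
`∑_{m ∣ P} h(m) = ∏_{p < N} (1 + h(p))`. [folklore] -/
theorem sum_divisors_prod_primesBelow_eq {h : ArithmeticFunction ℝ} (hh : h.IsMultiplicative) (N : ℕ) :
    ∑ m ∈ (∏ p ∈ N.primesBelow, p).divisors, h m = ∏ p ∈ N.primesBelow, (1 + h p) := by
  have hsq : Squarefree (∏ p ∈ N.primesBelow, p) := by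
    have := squarefree_primesProdBelow (N : ℝ)
    rwa [primesProdBelow, Nat.ceil_natCast] at this
  have hpf : (∏ p ∈ N.primesBelow, p).primeFactors = N.primesBelow :=
    Nat.primeFactors_prod fun _ hp => Nat.prime_of_mem_primesBelow hp
  rw [← hh.prodPrimeFactors_one_add_of_squarefree hsq, hpf]

/-- A squarefree `N`-smooth number divides `∏_{p<N} p`. [folklore] -/
theorem dvd_prod_primesBelow_of_smooth {m N : ℕ} (hm : Squarefree m) (hs : m ∈ N.smoothNumbers) :
    m ∣ ∏ p ∈ N.primesBelow, p := by
  rw [← Nat.prod_primeFactors_of_squarefree hm]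
  refine Finset.prod_dvd_prod_of_subset _ _ _ fun p hp => ?_
  rw [Nat.mem_primesBelow]
  exact ⟨Nat.mem_smoothNumbers'.mp hs p (Nat.prime_of_mem_primeFactors hp)
    (Nat.dvd_of_mem_primeFactors hp), Nat.prime_of_mem_primeFactors hp⟩

/-! ### Rankin's trick for the tail `H(y, z) = ∑_{m ∣ P(z), m > √y} g(m)` -/

/-- **Rankin bound for the smooth tail** (FI p. 1048:
"`H(y, z) ≤ y^{-ε} ∑_{m ∣ P(z)} g(m) m^{2ε} = y^{-ε} ∏_{p<z}(1 + g(p)p^{2ε}) ≤ y^{-ε} ∏_{p<z} (1 + 8g(p))`,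
`ε = (log z)⁻¹`"): for `y > 0`, `N ≥ 3` and `ε = 1/log N`,
`∑_{m ∣ P, m² > y} g(m) ≤ exp(-log y/log N) ∏_{p < N} (1 + 8 g(p))`, `P = ∏_{p<N} p`.
[cite: FriedlanderIwaniecASP1998, §2 p. 1048] -/
theorem sum_divisors_tail_le (hg : g.IsMultiplicative) (hg0 : ∀ p : ℕ, p.Prime → 0 ≤ g p)
    {y : ℝ} (hy : 0 < y) {N : ℕ} (hN : 3 ≤ N) :
    ∑ m ∈ ((∏ p ∈ N.primesBelow, p).divisors).filter (fun m : ℕ => y < (m : ℝ) ^ 2), g m ≤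
      Real.exp (-(Real.log y / Real.log N)) * ∏ p ∈ N.primesBelow, (1 + 8 * g p) := by
  classical
  have hN3 : (3 : ℝ) ≤ N := by exact_mod_cast hN
  have hlogN : 0 < Real.log N := Real.log_pos (by linarith)
  set ε : ℝ := 1 / Real.log N with hε
  have hε0 : 0 < ε := by positivity
  set P : ℕ := ∏ p ∈ N.primesBelow, p with hP
  have hP0 : P ≠ 0 := Finset.prod_ne_zero_iff.mpr fun p hp => (Nat.prime_of_mem_primesBelow hp).ne_zero
  -- the twisted function `h(m) = g(m) m^{2ε}`
  set pw : ArithmeticFunction ℝ := ⟨fun m => ((m : ℕ) : ℝ) ^ (2 * ε), by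
    show ((0 : ℕ) : ℝ) ^ (2 * ε) = 0
    rw [Nat.cast_zero, Real.zero_rpow (by positivity)]⟩ with hpw
  have hpw_apply : ∀ m : ℕ, pw m = (m : ℝ) ^ (2 * ε) := fun m => rfl
  have hpwm : pw.IsMultiplicative := by
    refine ⟨by rw [hpw_apply, Nat.cast_one, Real.one_rpow], fun {m n} _ => ?_⟩
    rw [hpw_apply, hpw_apply, hpw_apply, Nat.cast_mul,
      Real.mul_rpow (Nat.cast_nonneg m) (Nat.cast_nonneg n)]
  have hhm : (g.pmul pw).IsMultiplicative := hg.pmul hpwm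
  have hh_apply : ∀ m : ℕ, (g.pmul pw) m = g m * (m : ℝ) ^ (2 * ε) := fun m => by
    rw [ArithmeticFunction.pmul_apply, hpw_apply]
  -- Step 1: `g(m) ≤ y^{-ε} g(m) m^{2ε}` on the tail
  have hyε : Real.exp (-(Real.log y / Real.log N)) = y ^ (-ε) := by
    rw [Real.rpow_def_of_pos hy, hε]
    congr 1
    ring
  have step1 : ∑ m ∈ (P.divisors).filter (fun m : ℕ => y < (m : ℝ) ^ 2), g m ≤
      ∑ m ∈ (P.divisors).filter (fun m : ℕ => y < (m : ℝ) ^ 2), y ^ (-ε) * (g.pmul pw) m := by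
    refine Finset.sum_le_sum fun m hm => ?_
    obtain ⟨hmP, hym⟩ := Finset.mem_filter.mp hm
    have hm0 : (0 : ℝ) < m := by
      have := Nat.pos_of_mem_divisors hmP
      exact_mod_cast this
    have hmsq : Squarefree m := (squarefree_primesProdBelow (N : ℝ)).squarefree_of_dvd (by
      rw [primesProdBelow, Nat.ceil_natCast]; exact Nat.dvd_of_mem_divisors hmP)
    have hgm : 0 ≤ g m := ArithmeticFunction.IsMultiplicative.nonneg_of_squarefree hg hg0 hmsq
    rw [hh_apply]
    -- `1 ≤ y^{-ε} m^{2ε}` since `y < m²`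
    have h1 : 1 ≤ y ^ (-ε) * (m : ℝ) ^ (2 * ε) := by
      have : (m : ℝ) ^ (2 * ε) = ((m : ℝ) ^ 2) ^ ε := by
        rw [← Real.rpow_natCast, ← Real.rpow_mul hm0.le]; norm_num
      rw [this, Real.rpow_neg hy.le, ← Real.inv_rpow hy.le, ← Real.mul_rpow (inv_nonneg.mpr hy.le)
        (by positivity)]
      refine Real.one_le_rpow ?_ hε0.le
      rw [inv_mul_eq_div, le_div_iff₀ hy, one_mul]
      exact hym.le
    calc g m = g m * 1 := (mul_one _).symm
      _ ≤ g m * (y ^ (-ε) * (m : ℝ) ^ (2 * ε)) := mul_le_mul_of_nonneg_left h1 hgm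
      _ = y ^ (-ε) * (g m * (m : ℝ) ^ (2 * ε)) := by ring
  -- Step 2: extend to all divisors and evaluate the multiplicative sum
  have step2 : ∑ m ∈ (P.divisors).filter (fun m : ℕ => y < (m : ℝ) ^ 2), y ^ (-ε) * (g.pmul pw) m ≤
      y ^ (-ε) * ∏ p ∈ N.primesBelow, (1 + (g.pmul pw) p) := by
    rw [← sum_divisors_prod_primesBelow_eq hhm N, Finset.mul_sum]
    refine Finset.sum_le_sum_of_subset_of_nonneg (Finset.filter_subset _ _) fun m hm _ => ?_
    have hmsq : Squarefree m := (squarefree_primesProdBelow (N : ℝ)).squarefree_of_dvd (by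
      rw [primesProdBelow, Nat.ceil_natCast]; exact Nat.dvd_of_mem_divisors hm)
    rw [hh_apply]
    exact mul_nonneg (Real.rpow_nonneg hy.le _)
      (mul_nonneg (ArithmeticFunction.IsMultiplicative.nonneg_of_squarefree hg hg0 hmsq)
        (Real.rpow_nonneg (Nat.cast_nonneg m) _))
  -- Step 3: `p^{2ε} ≤ e² ≤ 8` for `p < N`
  have step3 : ∏ p ∈ N.primesBelow, (1 + (g.pmul pw) p) ≤ ∏ p ∈ N.primesBelow, (1 + 8 * g p) := by
    refine Finset.prod_le_prod (fun p hp => ?_) fun p hp => ?_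
    · rw [hh_apply]
      have := hg0 p (Nat.prime_of_mem_primesBelow hp)
      positivity
    · rw [hh_apply]
      obtain ⟨hpN, hpp⟩ := Nat.mem_primesBelow.mp hp
      have hp0 : (0 : ℝ) < p := by exact_mod_cast hpp.pos
      have hple : (p : ℝ) ^ (2 * ε) ≤ 8 := by
        rw [Real.rpow_def_of_pos hp0]
        have hlogp : Real.log p ≤ Real.log N := Real.log_le_log hp0 (by exact_mod_cast hpN.le)
        have h2 : Real.log p * (2 * ε) ≤ 2 := by
          rw [hε]
          calc Real.log p * (2 * (1 / Real.log N)) = 2 * (Real.log p / Real.log N) := by ring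
            _ ≤ 2 * 1 := by gcongr; exact (div_le_one hlogN).mpr hlogp
            _ = 2 := by ring
        calc Real.exp (Real.log p * (2 * ε)) ≤ Real.exp 2 := Real.exp_le_exp.mpr h2
          _ ≤ 8 := by
              have h1 := Real.exp_one_lt_d9
              have : Real.exp 2 = Real.exp 1 * Real.exp 1 := by rw [← Real.exp_add]; norm_num
              rw [this]; nlinarith [Real.exp_pos 1]
      have hgp := hg0 p hpp
      nlinarith
  calc ∑ m ∈ (P.divisors).filter (fun m : ℕ => y < (m : ℝ) ^ 2), g m
      ≤ y ^ (-ε) * ∏ p ∈ N.primesBelow, (1 + (g.pmul pw) p) := step1.trans step2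
    _ ≤ y ^ (-ε) * ∏ p ∈ N.primesBelow, (1 + 8 * g p) :=
        mul_le_mul_of_nonneg_left step3 (Real.rpow_nonneg hy.le _)
    _ = Real.exp (-(Real.log y / Real.log N)) * ∏ p ∈ N.primesBelow, (1 + 8 * g p) := by rw [hyε]

/-! ### The error `h(z)` on prime intervals -/

/-- From two instances of (1.9) (for `f(p)` and `g(p)` with constants `(c_f, K_f)`, `(c_g, K_g)`):
for `3 ≤ u` and all `v`,
`|∑_{u ≤ p ≤ v} (f(p) - g(p))| ≤ 2(|K_f| + |K_g|)/(log(u-1))^{10}` (difference of the four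
partial sums at `v` and `u - 1`). [cite: FriedlanderIwaniecASP1998, §2 p. 1049] -/
theorem abs_sum_primes_Icc_sub_le {f g : ℕ → ℝ} {cf Kf cg Kg : ℝ}
    (hf : ∀ y : ℝ, 2 ≤ y →
      |(∑ p ∈ Nat.primesLE ⌊y⌋₊, f p) - (Real.log (Real.log y) + cf)| ≤ Kf / Real.log y ^ 10)
    (hgg : ∀ y : ℝ, 2 ≤ y →
      |(∑ p ∈ Nat.primesLE ⌊y⌋₊, g p) - (Real.log (Real.log y) + cg)| ≤ Kg / Real.log y ^ 10)
    {u : ℕ} (hu : 3 ≤ u) (v : ℕ) :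
    |∑ p ∈ (Icc u v).filter Nat.Prime, (f p - g p)| ≤
      2 * (|Kf| + |Kg|) / Real.log ((u - 1 : ℕ) : ℝ) ^ 10 := by
  have hu1 : 2 ≤ u - 1 := by omega
  have hu1r : (2 : ℝ) ≤ ((u - 1 : ℕ) : ℝ) := by exact_mod_cast hu1
  have hlog1 : 0 < Real.log ((u - 1 : ℕ) : ℝ) := Real.log_pos (by linarith)
  have hK0 : 0 ≤ 2 * (|Kf| + |Kg|) / Real.log ((u - 1 : ℕ) : ℝ) ^ 10 := by positivity
  rcases lt_or_ge v u with hvu | huv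
  · have : (Icc u v).filter Nat.Prime = ∅ := by
      rw [Finset.filter_eq_empty_iff]
      intro p hp
      have := Finset.mem_Icc.mp hp
      omega
    rw [this, Finset.sum_empty, abs_zero]
    exact hK0
  -- the interval of primes as a difference of `primesLE`
  have hset : (Icc u v).filter Nat.Prime = Nat.primesLE v \ Nat.primesLE (u - 1) := by
    ext p
    simp only [Finset.mem_filter, Finset.mem_Icc, Finset.mem_sdiff, Nat.mem_primesLE]
    constructor
    · rintro ⟨⟨h1, h2⟩, hp⟩
      exact ⟨⟨h2, hp⟩, fun h => by omega⟩
    · rintro ⟨⟨h2, hp⟩, h3⟩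
      refine ⟨⟨?_, h2⟩, hp⟩
      by_contra hlt
      exact h3 ⟨by omega, hp⟩
  have hsub : Nat.primesLE (u - 1) ⊆ Nat.primesLE v := by
    intro p hp
    rw [Nat.mem_primesLE] at hp ⊢
    exact ⟨by omega, hp.2⟩
  have hdiff : ∀ w : ℕ → ℝ, ∑ p ∈ (Icc u v).filter Nat.Prime, w p =
      ∑ p ∈ Nat.primesLE v, w p - ∑ p ∈ Nat.primesLE (u - 1), w p := by
    intro w
    rw [hset, Finset.sum_sdiff_eq_sub hsub]
  have hv2 : (2 : ℝ) ≤ (v : ℝ) := by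
    have : u ≤ v := huv
    have : (3 : ℝ) ≤ v := by exact_mod_cast hu.trans this
    linarith
  have hlogv : Real.log ((u - 1 : ℕ) : ℝ) ≤ Real.log v :=
    Real.log_le_log (by linarith) (by exact_mod_cast (show u - 1 ≤ v by omega))
  -- the four (1.9)-instances at the natural numbers `v` and `u - 1`
  have hfv := hf v hv2
  have hfu := hf ((u - 1 : ℕ) : ℝ) hu1r
  have hgv := hgg v hv2
  have hgu := hgg ((u - 1 : ℕ) : ℝ) hu1r
  rw [Nat.floor_natCast] at hfv hfu hgv hgu
  rw [Finset.sum_sub_distrib, hdiff f, hdiff g]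
  -- bound each error by `|K|/(log(u-1))^10`
  have hb : ∀ {K : ℝ} {x : ℝ}, Real.log ((u - 1 : ℕ) : ℝ) ≤ Real.log x →
      K / Real.log x ^ 10 ≤ |K| / Real.log ((u - 1 : ℕ) : ℝ) ^ 10 := by
    intro K x hx
    have hx0 : 0 < Real.log x := hlog1.trans_le hx
    calc K / Real.log x ^ 10 ≤ |K| / Real.log x ^ 10 :=
          div_le_div_of_nonneg_right (le_abs_self K) (by positivity)
      _ ≤ |K| / Real.log ((u - 1 : ℕ) : ℝ) ^ 10 := by
          refine div_le_div_of_nonneg_left (abs_nonneg K) (by positivity) ?_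
          gcongr
  have e1 := (abs_le.mp (hfv.trans (hb hlogv)))
  have e2 := (abs_le.mp (hfu.trans (hb le_rfl)))
  have e3 := (abs_le.mp (hgv.trans (hb hlogv)))
  have e4 := (abs_le.mp (hgu.trans (hb le_rfl)))
  have hsplit : 2 * (|Kf| + |Kg|) / Real.log ((u - 1 : ℕ) : ℝ) ^ 10 =
      |Kf| / Real.log ((u - 1 : ℕ) : ℝ) ^ 10 + |Kf| / Real.log ((u - 1 : ℕ) : ℝ) ^ 10 +
        (|Kg| / Real.log ((u - 1 : ℕ) : ℝ) ^ 10 + |Kg| / Real.log ((u - 1 : ℕ) : ℝ) ^ 10) := by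
    ring
  rw [hsplit, abs_le]
  constructor <;> linarith [e1.1, e1.2, e2.1, e2.2, e3.1, e3.2, e4.1, e4.2]

/-- `∑_{i ∈ s} x_i ≤ ∏_{i ∈ s} (1 + x_i)` for `x ≥ 0`. [folklore] -/
theorem sum_le_prod_one_add {ι : Type*} (s : Finset ι) {x : ι → ℝ} (hx : ∀ i ∈ s, 0 ≤ x i) :
    ∑ i ∈ s, x i ≤ ∏ i ∈ s, (1 + x i) := by
  classical
  induction s using Finset.induction_on with
  | empty => simp
  | insert a s ha ih =>
    rw [Finset.sum_insert ha, Finset.prod_insert ha]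
    have hxa : 0 ≤ x a := hx a (Finset.mem_insert_self a s)
    have hs : ∀ i ∈ s, 0 ≤ x i := fun i hi => hx i (Finset.mem_insert_of_mem hi)
    have ih' := ih hs
    have hprod : 1 ≤ ∏ i ∈ s, (1 + x i) := by
      calc (1 : ℝ) = ∏ i ∈ s, (1 : ℝ) := by simp
        _ ≤ ∏ i ∈ s, (1 + x i) :=
            Finset.prod_le_prod (fun i _ => zero_le_one) fun i hi => by linarith [hs i hi]
    nlinarith [Finset.sum_nonneg hs]

/-- **The `ν`-part of `h(z)`** (FI p. 1049: "`h(z) ≪ ∑_{p ≥ z, p ∣ ν} p⁻¹ + (log z)^{-10} ≪ σ_ν (log z)^{-10}`"):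
`∑_{p ∣ ν, p ≥ N} 1/p ≤ σ_ν/√N`, since `σ_ν ≥ ∑_{p ∣ ν} p^{-1/2} ≥ √N ∑_{p ∣ ν, p ≥ N} p⁻¹`.
[cite: FriedlanderIwaniecASP1998, §2 p. 1049] -/
theorem sum_primeFactors_inv_le_sigmaHalf_div_sqrt (ν : ℕ) {N : ℕ} (hN : 1 ≤ N) :
    ∑ p ∈ ν.primeFactors.filter (fun p => N ≤ p), (p : ℝ)⁻¹ ≤ sigmaHalf ν / Real.sqrt N := by
  have hN0 : (0 : ℝ) < N := by exact_mod_cast hN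
  have hsN : 0 < Real.sqrt N := Real.sqrt_pos.mpr hN0
  rw [sigmaHalf, le_div_iff₀ hsN]
  calc (∑ p ∈ ν.primeFactors.filter (fun p => N ≤ p), (p : ℝ)⁻¹) * Real.sqrt N
      = ∑ p ∈ ν.primeFactors.filter (fun p => N ≤ p), (p : ℝ)⁻¹ * Real.sqrt N := Finset.sum_mul _ _ _
    _ ≤ ∑ p ∈ ν.primeFactors.filter (fun p => N ≤ p), (Real.sqrt p)⁻¹ := by
        refine Finset.sum_le_sum fun p hp => ?_
        obtain ⟨hpν, hNp⟩ := Finset.mem_filter.mp hp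
        have hp0 : (0 : ℝ) < p := by exact_mod_cast (Nat.prime_of_mem_primeFactors hpν).pos
        have hsp : 0 < Real.sqrt p := Real.sqrt_pos.mpr hp0
        have hNp' : Real.sqrt N ≤ Real.sqrt p := Real.sqrt_le_sqrt (by exact_mod_cast hNp)
        rw [← Real.sq_sqrt hp0.le] 
        rw [Real.sqrt_sq hsp.le]
        rw [show ((Real.sqrt p) ^ 2)⁻¹ * Real.sqrt N = (Real.sqrt p)⁻¹ * (Real.sqrt N / Real.sqrt p) by
          field_simp]
        calc (Real.sqrt p)⁻¹ * (Real.sqrt N / Real.sqrt p) ≤ (Real.sqrt p)⁻¹ * 1 := by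
              refine mul_le_mul_of_nonneg_left ((div_le_one hsp).mpr hNp') (inv_nonneg.mpr hsp.le)
          _ = (Real.sqrt p)⁻¹ := mul_one _
    _ ≤ ∑ p ∈ ν.primeFactors, (Real.sqrt p)⁻¹ :=
        Finset.sum_le_sum_of_subset_of_nonneg (Finset.filter_subset _ _) fun p _ _ =>
          inv_nonneg.mpr (Real.sqrt_nonneg _)
    _ ≤ ∏ p ∈ ν.primeFactors, (1 + (Real.sqrt p)⁻¹) :=
        sum_le_prod_one_add _ fun p _ => inv_nonneg.mpr (Real.sqrt_nonneg _)

/-- `1/√x ≤ 20^{10}/(log x)^{10}` for `x > 1` (`log x ≤ 20 x^{1/20}`). [folklore] -/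
theorem inv_sqrt_le_div_log_pow {x : ℝ} (hx : 1 < x) :
    (Real.sqrt x)⁻¹ ≤ (20 : ℝ) ^ 10 / Real.log x ^ 10 := by
  have hx0 : 0 < x := by linarith
  have hlog : 0 < Real.log x := Real.log_pos hx
  have h1 : Real.log x ≤ x ^ (1 / 20 : ℝ) / (1 / 20) := Real.log_le_rpow_div hx0.le (by norm_num)
  have h2 : Real.log x ≤ 20 * x ^ (1 / 20 : ℝ) := by linarith
  have h3 : Real.log x ^ 10 ≤ (20 : ℝ) ^ 10 * Real.sqrt x := by
    calc Real.log x ^ 10 ≤ (20 * x ^ (1 / 20 : ℝ)) ^ 10 := by gcongr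
      _ = (20 : ℝ) ^ 10 * (x ^ (1 / 20 : ℝ)) ^ 10 := mul_pow _ _ _
      _ = (20 : ℝ) ^ 10 * Real.sqrt x := by
          congr 1
          rw [← Real.rpow_natCast, ← Real.rpow_mul hx0.le, Real.sqrt_eq_rpow]
          norm_num
  rw [inv_le_comm₀ (Real.sqrt_pos.mpr hx0) (by positivity), inv_div, div_le_iff₀ (by positivity)]
  linarith

/-! ### Elementary inequalities for the final bookkeeping -/

/-- `exp(-c √t) ≤ 16!/(c^{16} t^8)` for `c, t > 0`. [folklore] -/
theorem exp_neg_mul_sqrt_le {c t : ℝ} (hc : 0 < c) (ht : 0 < t) :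
    Real.exp (-(c * Real.sqrt t)) ≤ (Nat.factorial 16 : ℝ) / (c ^ 16 * t ^ 8) := by
  have h := LFunctions.pow_mul_pow_div_factorial_le_exp_sqrt hc.le ht.le 8
  rw [Real.exp_neg, inv_le_comm₀ (Real.exp_pos _) (by positivity), inv_div]
  simpa using h

/-- `exp(a u - u²/b) ≤ exp(a² b/4)` for `b > 0` (completing the square). [folklore] -/
theorem exp_linear_sub_sq_le (a u : ℝ) {b : ℝ} (hb : 0 < b) :
    Real.exp (a * u - u ^ 2 / b) ≤ Real.exp (a ^ 2 * b / 4) := by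
  rw [Real.exp_le_exp]
  have : 0 ≤ (u - a * b / 2) ^ 2 / b := by positivity
  have e : a * u - u ^ 2 / b = a ^ 2 * b / 4 - (u - a * b / 2) ^ 2 / b := by
    field_simp
    ring
  linarith

/-- `(log t)^{20} ≤ 20^{20} t` for `t ≥ 1`. [folklore] -/
theorem log_pow_twenty_le {t : ℝ} (ht : 1 ≤ t) : Real.log t ^ 20 ≤ (20 : ℝ) ^ 20 * t := by
  have ht0 : 0 < t := by linarith
  have h1 : Real.log t ≤ t ^ (1 / 20 : ℝ) / (1 / 20) := Real.log_le_rpow_div ht0.le (by norm_num)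
  have h2 : Real.log t ≤ 20 * t ^ (1 / 20 : ℝ) := by linarith
  calc Real.log t ^ 20 ≤ (20 * t ^ (1 / 20 : ℝ)) ^ 20 := by
        gcongr
        exact Real.log_nonneg ht
    _ = (20 : ℝ) ^ 20 * (t ^ (1 / 20 : ℝ)) ^ 20 := mul_pow _ _ _
    _ = (20 : ℝ) ^ 20 * t := by
        congr 1
        rw [← Real.rpow_natCast, ← Real.rpow_mul ht0.le]
        norm_num

end FICancellation

end Literature.NumberTheory.Sieve


namespace Literature.NumberTheory.Sieve

namespace FICancellation

open Finset Real
open scoped ArithmeticFunction.Moebius ArithmeticFunction.zeta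

/-! ### The structural bound for `G_ν(y)` -/

/-- `∑_{n ≤ M sqfree} 1/n ≤ 1 + log M` (harmonic bound). [folklore] -/
theorem sum_squarefree_inv_le (M : ℕ) :
    ∑ n ∈ (Icc 1 M).filter Squarefree, ((n : ℕ) : ℝ)⁻¹ ≤ 1 + Real.log M := by
  calc ∑ n ∈ (Icc 1 M).filter Squarefree, ((n : ℕ) : ℝ)⁻¹
      ≤ ∑ n ∈ Icc 1 M, ((n : ℕ) : ℝ)⁻¹ :=
        Finset.sum_le_sum_of_subset_of_nonneg (Finset.filter_subset _ _) fun n _ _ => by positivity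
    _ = ((harmonic M : ℚ) : ℝ) := by
        rw [harmonic_eq_sum_Icc]; push_cast; rfl
    _ ≤ 1 + Real.log M := harmonic_le_one_add_log M

set_option maxHeartbeats 400000 in
/-- **Structural bound for `G_ν(y) = ∑_{d ≤ y, (d,ν)=1} μ(d) g(d)`** (FI pp. 1048–1049 with every
constant explicit). Under (1.8), (1.9) for `g`, (1.9) for `f(p) = 1/p` (constants `c_f, K_f`) and the
bound `|∑_{k ≤ x} μ(k)/k| ≤ C e^{-c√log x}` (`x ≥ 2`): for `ν ≥ 1`, `y ≥ 4`, `N ≥ 8`, writing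
`P = ∏_{p<N} p`, `K₃ = exp(|c₁| + |K₂|(log 2)^{-10})`,
`h = 2(|K_f| + |K₂|)/(log(N-1))^{10} + K₁ σ_ν/√N`,
`|G_ν(y)| ≤ ∏_{p<N}(1 + g(p)) · [(C+1)e^{c+5} log N e^{-(c/2)√(log y/2)}
   + (C+1)(e⁵ log N)^{12} e^{-log y/(4 log N)} + h (1 + log y) K₃ log y]
   + K₃ log y · e^{-log y/log N} ∏_{p<N}(1 + 8g(p))`.
The three lines are: the comparison `G_ν(w,z) = F(w,z) + O(h · ∑♭ f · ∑♭ g)` together with the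
bound for `F` (smooth `m ≤ √y`), and the Rankin tail `H(y,z)` (smooth `m > √y`).
[cite: FriedlanderIwaniecASP1998, §2 pp. 1048–1049] -/
theorem abs_sum_coprime_moebius_density_le
    {g : ArithmeticFunction ℝ} (hg : g.IsMultiplicative)
    {K₁ : ℝ} (hK₁ : 0 ≤ K₁) (h18 : ∀ p : ℕ, p.Prime → 0 ≤ g p ∧ g p < 1 ∧ g p ≤ K₁ / p)
    {c₁ K₂ : ℝ} (h19 : ∀ y : ℝ, 2 ≤ y →
      |(∑ p ∈ Nat.primesLE ⌊y⌋₊, g p) - (Real.log (Real.log y) + c₁)| ≤ K₂ / Real.log y ^ 10)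
    {cf Kf : ℝ} (h19f : ∀ y : ℝ, 2 ≤ y →
      |(∑ p ∈ Nat.primesLE ⌊y⌋₊, (p : ℝ)⁻¹) - (Real.log (Real.log y) + cf)| ≤ Kf / Real.log y ^ 10)
    {c C : ℝ} (hc : 0 < c) (hC : 0 ≤ C)
    (hm : ∀ x : ℝ, 2 ≤ x →
      |∑ k ∈ Icc 1 ⌊x⌋₊, (μ k : ℝ) / k| ≤ C * Real.exp (-c * Real.sqrt (Real.log x)))
    {ν : ℕ} (hν : 1 ≤ ν) {y : ℝ} (hy : 4 ≤ y) {N : ℕ} (hN : 8 ≤ N) :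
    |∑ d ∈ (Icc 1 ⌊y⌋₊).filter (fun d : ℕ => d.Coprime ν), (μ d : ℝ) * g d| ≤
      (∏ p ∈ N.primesBelow, (1 + g p)) *
        ((C + 1) * Real.exp (c + 5) * Real.log N *
            Real.exp (-(c / 2) * Real.sqrt (Real.log y / 2)) +
          (C + 1) * (Real.exp 5 * Real.log N) ^ 12 * Real.exp (-(Real.log y / (4 * Real.log N))) +
          (2 * (|Kf| + |K₂|) / Real.log ((N - 1 : ℕ) : ℝ) ^ 10 + K₁ * sigmaHalf ν / Real.sqrt N) *
            (1 + Real.log y) * (Real.exp (|c₁| + |K₂| / Real.log 2 ^ 10) * Real.log y)) +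
      Real.exp (|c₁| + |K₂| / Real.log 2 ^ 10) * Real.log y *
        (Real.exp (-(Real.log y / Real.log N)) * ∏ p ∈ N.primesBelow, (1 + 8 * g p)) := by
  classical
  -- basic ranges
  have hy2 : 2 ≤ y := by linarith
  have hy0 : 0 < y := by linarith
  have hy1 : 1 ≤ y := by linarith
  obtain ⟨Y, hY⟩ : ∃ Y : ℕ, Y = ⌊y⌋₊ := ⟨_, rfl⟩
  rw [← hY]
  have hY2 : 2 ≤ Y := by
    rw [hY]; exact Nat.le_floor (by norm_num; linarith)
  have hY1 : 1 ≤ Y := by omega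
  have hYy : (Y : ℝ) ≤ y := by rw [hY]; exact Nat.floor_le hy0.le
  obtain ⟨t, ht⟩ : ∃ t : ℝ, t = Real.log y := ⟨_, rfl⟩
  rw [← ht]
  have ht2 : Real.log 2 ≤ t := by rw [ht]; exact Real.log_le_log two_pos hy2
  have hl2 : 0 < Real.log 2 := Real.log_pos one_lt_two
  have ht0 : 0 < t := hl2.trans_le ht2
  have hlogY : Real.log Y ≤ t := by
    rw [ht]; exact Real.log_le_log (by exact_mod_cast (show 0 < Y by omega)) hYy
  have hN3 : 3 ≤ N := by omega
  have hN8 : (8 : ℝ) ≤ N := by exact_mod_cast hN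
  have hlogN0 : 0 < Real.log N := Real.log_pos (by linarith)
  have hsqN : 0 < Real.sqrt N := Real.sqrt_pos.mpr (by linarith)
  have hN1 : (7 : ℝ) ≤ ((N - 1 : ℕ) : ℝ) := by
    rw [Nat.cast_sub (by omega)]; push_cast; linarith
  have hlogN1 : 0 < Real.log ((N - 1 : ℕ) : ℝ) := Real.log_pos (by linarith)
  obtain ⟨K₃, hK₃⟩ : ∃ K : ℝ, K = Real.exp (|c₁| + |K₂| / Real.log 2 ^ 10) := ⟨_, rfl⟩
  rw [← hK₃]
  have hK₃1 : 1 ≤ K₃ := by rw [hK₃]; exact Real.one_le_exp (by positivity)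
  have hK₃0 : 0 ≤ K₃ := zero_le_one.trans hK₃1
  have hg0 : ∀ p : ℕ, p.Prime → 0 ≤ g p := fun p hp => (h18 p hp).1
  obtain ⟨P, hP⟩ : ∃ P : ℕ, P = ∏ p ∈ N.primesBelow, p := ⟨_, rfl⟩
  obtain ⟨σ, hσ⟩ : ∃ s : ℝ, s = sigmaHalf ν := ⟨_, rfl⟩
  rw [← hσ]
  have hσ1 : 1 ≤ σ := by rw [hσ]; exact one_le_sigmaHalf ν
  obtain ⟨hval, hhval⟩ : ∃ h : ℝ,
      h = 2 * (|Kf| + |K₂|) / Real.log ((N - 1 : ℕ) : ℝ) ^ 10 + K₁ * σ / Real.sqrt N := ⟨_, rfl⟩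
  rw [← hhval]
  have hhval0 : 0 ≤ hval := by rw [hhval]; positivity
  -- the three multiplicative functions
  obtain ⟨A, hA_apply⟩ : ∃ A : ArithmeticFunction ℝ,
      ∀ d : ℕ, A d = if d.Coprime ν then (μ d : ℝ) * g d else 0 :=
    ⟨⟨fun d => if d.Coprime ν then (μ d : ℝ) * g d else 0, by simp⟩, fun d => rfl⟩
  obtain ⟨gν, hgν_apply⟩ : ∃ G : ArithmeticFunction ℝ,
      ∀ n : ℕ, G n = if n.Coprime ν then g n else 0 :=
    ⟨⟨fun n => if n.Coprime ν then g n else 0, by simp⟩, fun n => rfl⟩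
  obtain ⟨fi, hfi_apply⟩ : ∃ F : ArithmeticFunction ℝ, ∀ n : ℕ, F n = ((n : ℕ) : ℝ)⁻¹ :=
    ⟨⟨fun n => ((n : ℕ) : ℝ)⁻¹, by simp⟩, fun n => rfl⟩
  have hgνm : gν.IsMultiplicative := by
    refine ⟨?_, ?_⟩
    · rw [hgν_apply, if_pos (Nat.coprime_one_left _), hg.map_one]
    · intro m n hmn
      rw [hgν_apply, hgν_apply, hgν_apply, hg.map_mul_of_coprime hmn]
      by_cases hm : m.Coprime ν
      · by_cases hn' : n.Coprime ν
        · rw [if_pos (Nat.Coprime.mul_left hm hn'), if_pos hm, if_pos hn']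
        · rw [if_neg (fun h => hn' (Nat.coprime_mul_iff_left.mp h).2), if_pos hm, if_neg hn',
            mul_zero]
      · rw [if_neg (fun h => hm (Nat.coprime_mul_iff_left.mp h).1), if_neg hm, zero_mul]
  have hA_eq : ∀ d : ℕ, A d = (μ d : ℝ) * gν d := fun d => by
    rw [hA_apply, hgν_apply]; split_ifs <;> simp
  have hAm : A.IsMultiplicative := by
    have : A = (μ : ArithmeticFunction ℝ).pmul gν := by
      ext d; rw [hA_eq, ArithmeticFunction.pmul_apply, ArithmeticFunction.intCoe_apply]
    rw [this]
    exact ArithmeticFunction.isMultiplicative_moebius.intCast.pmul hgνm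
  have hfim : fi.IsMultiplicative := by
    refine ⟨by rw [hfi_apply, Nat.cast_one, inv_one], fun {m n} _ => ?_⟩
    rw [hfi_apply, hfi_apply, hfi_apply, Nat.cast_mul, mul_inv]
  have hgν0 : ∀ p : ℕ, p.Prime → 0 ≤ gν p := fun p hp => by
    rw [hgν_apply]; split_ifs
    · exact hg0 p hp
    · exact le_rfl
  have hgν_le : ∀ n : ℕ, Squarefree n → gν n ≤ g n := fun n hn => by
    rw [hgν_apply]; split_ifs
    · exact le_rfl
    · exact ArithmeticFunction.IsMultiplicative.nonneg_of_squarefree hg hg0 hn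
  have hfi0 : ∀ p : ℕ, p.Prime → 0 ≤ fi p := fun p _ => by rw [hfi_apply]; positivity
  -- Step 0: the sum as a full sum of `A`
  have hstep0 : ∑ d ∈ (Icc 1 Y).filter (fun d : ℕ => d.Coprime ν), (μ d : ℝ) * g d =
      ∑ d ∈ Icc 1 Y, A d := by
    rw [Finset.sum_filter]
    exact Finset.sum_congr rfl fun d _ => (hA_apply d).symm
  -- Step 1: smooth–rough factorisation
  have hstep1 := FIComparison.sum_eq_sum_smooth_mul_sum_coprime hAm N Y
  rw [← hP] at hstep1
  -- Step 2: the inner sums `G(M)` and `F(M)` as sums over `((Icc 1 M).filter (fun n => Squarefree n ∧ ∀ q ∈ n.primeFactors, N ≤ q))`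
  have hG_eq : ∀ M : ℕ, ∑ n ∈ (Icc 1 M).filter (fun n => n.Coprime P), A n =
      ∑ n ∈ ((Icc 1 M).filter (fun n => Squarefree n ∧ ∀ q ∈ n.primeFactors, N ≤ q)), (μ n : ℝ) * gν n := fun M => by
    simp_rw [hA_eq, hP]
    exact FIComparison.sum_coprime_moebius_mul_eq_sum_roughSquarefree (fun n => gν n) M N
  have hF_eq : ∀ M : ℕ, ∑ n ∈ (Icc 1 M).filter (fun n => n.Coprime P), (μ n : ℝ) / n =
      ∑ n ∈ ((Icc 1 M).filter (fun n => Squarefree n ∧ ∀ q ∈ n.primeFactors, N ≤ q)), (μ n : ℝ) * fi n := fun M => by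
    simp_rw [div_eq_mul_inv, hfi_apply, hP]
    exact FIComparison.sum_coprime_moebius_mul_eq_sum_roughSquarefree (fun n => ((n : ℕ) : ℝ)⁻¹) M N
  -- Step 3: the hypothesis of the comparison lemma on prime intervals
  have hprimes : ∀ u v : ℕ, N ≤ u → |∑ p ∈ (Icc u v).filter Nat.Prime, (fi p - gν p)| ≤ hval := by
    intro u v hu
    have hu3 : 3 ≤ u := by omega
    -- split `fi - gν = (fi - g) + (g - gν)`
    have hsplit : ∑ p ∈ (Icc u v).filter Nat.Prime, (fi p - gν p) =
        ∑ p ∈ (Icc u v).filter Nat.Prime, (((p : ℕ) : ℝ)⁻¹ - g p) +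
          ∑ p ∈ (Icc u v).filter Nat.Prime, (g p - gν p) := by
      rw [← Finset.sum_add_distrib]
      refine Finset.sum_congr rfl fun p _ => ?_
      rw [hfi_apply]; ring
    -- first part from the two (1.9)'s
    have h1 := abs_sum_primes_Icc_sub_le (f := fun p : ℕ => ((p : ℕ) : ℝ)⁻¹) (g := fun p => g p)
      h19f h19 hu3 v
    have h1' : |∑ p ∈ (Icc u v).filter Nat.Prime, (((p : ℕ) : ℝ)⁻¹ - g p)| ≤
        2 * (|Kf| + |K₂|) / Real.log ((N - 1 : ℕ) : ℝ) ^ 10 := by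
      refine h1.trans (div_le_div_of_nonneg_left (by positivity) (by positivity) ?_)
      refine pow_le_pow_left₀ hlogN1.le (Real.log_le_log (by linarith) ?_) 10
      exact_mod_cast Nat.sub_le_sub_right hu 1
    -- second part: `0 ≤ ∑ (g - gν) ≤ ∑_{p ∣ ν, p ≥ N} g p ≤ K₁ σ/√N`
    have h2 : |∑ p ∈ (Icc u v).filter Nat.Prime, (g p - gν p)| ≤ K₁ * σ / Real.sqrt N := by
      have hterm : ∀ p ∈ (Icc u v).filter Nat.Prime,
          g p - gν p = if p ∣ ν then g p else 0 := by
        intro p hp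
        have hpp := (Finset.mem_filter.mp hp).2
        rw [hgν_apply]
        by_cases hd : p ∣ ν
        · rw [if_neg (fun hcop => ?_), if_pos hd, sub_zero]
          exact (Nat.Prime.coprime_iff_not_dvd hpp).mp hcop hd
        · rw [if_pos ((Nat.Prime.coprime_iff_not_dvd hpp).mpr hd), if_neg hd, sub_self]
      rw [Finset.sum_congr rfl hterm, ← Finset.sum_filter]
      have hnonneg : 0 ≤ ∑ p ∈ ((Icc u v).filter Nat.Prime).filter (fun p => p ∣ ν), g p :=
        Finset.sum_nonneg fun p hp =>
          hg0 p (Finset.mem_filter.mp (Finset.mem_filter.mp hp).1).2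
      rw [abs_of_nonneg hnonneg]
      calc ∑ p ∈ ((Icc u v).filter Nat.Prime).filter (fun p => p ∣ ν), g p
          ≤ ∑ p ∈ ν.primeFactors.filter (fun p => N ≤ p), g p := by
            refine Finset.sum_le_sum_of_subset_of_nonneg ?_ fun p hp _ =>
              hg0 p (Nat.prime_of_mem_primeFactors (Finset.mem_filter.mp hp).1)
            intro p hp
            obtain ⟨hp1, hpd⟩ := Finset.mem_filter.mp hp
            obtain ⟨hpI, hpp⟩ := Finset.mem_filter.mp hp1
            refine Finset.mem_filter.mpr ⟨Nat.mem_primeFactors.mpr ⟨hpp, hpd, by omega⟩, ?_⟩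
            exact hu.trans (Finset.mem_Icc.mp hpI).1
        _ ≤ ∑ p ∈ ν.primeFactors.filter (fun p => N ≤ p), K₁ * ((p : ℕ) : ℝ)⁻¹ := by
            refine Finset.sum_le_sum fun p hp => ?_
            have hpp := Nat.prime_of_mem_primeFactors (Finset.mem_filter.mp hp).1
            rw [← div_eq_mul_inv]
            exact (h18 p hpp).2.2
        _ = K₁ * ∑ p ∈ ν.primeFactors.filter (fun p => N ≤ p), ((p : ℕ) : ℝ)⁻¹ := by
            rw [Finset.mul_sum]
        _ ≤ K₁ * (σ / Real.sqrt N) := by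
            rw [hσ]
            exact mul_le_mul_of_nonneg_left
              (sum_primeFactors_inv_le_sigmaHalf_div_sqrt ν (N := N) (by omega)) hK₁
        _ = K₁ * σ / Real.sqrt N := by ring
    rw [hsplit]
    exact (abs_add_le _ _).trans (by rw [hhval]; exact add_le_add h1' h2)
  -- Step 4: size bounds for the auxiliary sums, for `M ≤ Y`
  have hSg : ∀ {M : ℕ}, M ≤ Y → ∑ n ∈ ((Icc 1 M).filter (fun n => Squarefree n ∧ ∀ q ∈ n.primeFactors, N ≤ q)), gν n ≤ K₃ * t := by
    intro M hM
    calc ∑ n ∈ ((Icc 1 M).filter (fun n => Squarefree n ∧ ∀ q ∈ n.primeFactors, N ≤ q)), gν n ≤ ∑ n ∈ (Icc 1 Y).filter Squarefree, g n := by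
          calc ∑ n ∈ ((Icc 1 M).filter (fun n => Squarefree n ∧ ∀ q ∈ n.primeFactors, N ≤ q)), gν n ≤ ∑ n ∈ ((Icc 1 M).filter (fun n => Squarefree n ∧ ∀ q ∈ n.primeFactors, N ≤ q)), g n :=
                Finset.sum_le_sum fun n hn => hgν_le n (Finset.mem_filter.mp hn).2.1
            _ ≤ ∑ n ∈ (Icc 1 Y).filter Squarefree, g n := by
                refine Finset.sum_le_sum_of_subset_of_nonneg ?_ fun n hn _ =>
                  ArithmeticFunction.IsMultiplicative.nonneg_of_squarefree hg hg0
                    (Finset.mem_filter.mp hn).2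
                intro n hn
                obtain ⟨hnI, hsq, -⟩ := Finset.mem_filter.mp hn
                exact Finset.mem_filter.mpr
                  ⟨Finset.Icc_subset_Icc_right hM hnI, hsq⟩
      _ ≤ K₃ * Real.log Y := by rw [hK₃]; exact sum_squarefree_density_le hg hg0 h19 hY2
      _ ≤ K₃ * t := mul_le_mul_of_nonneg_left hlogY hK₃0
  have hSf : ∀ {M : ℕ}, M ≤ Y → ∑ n ∈ (Icc 1 M).filter Squarefree, fi n ≤ 1 + t := by
    intro M hM
    rcases Nat.eq_zero_or_pos M with rfl | hMpos
    · simp; linarith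
    calc ∑ n ∈ (Icc 1 M).filter Squarefree, fi n
        = ∑ n ∈ (Icc 1 M).filter Squarefree, ((n : ℕ) : ℝ)⁻¹ :=
          Finset.sum_congr rfl fun n _ => hfi_apply n
      _ ≤ 1 + Real.log M := sum_squarefree_inv_le M
      _ ≤ 1 + t := by
          have : Real.log M ≤ Real.log Y :=
            Real.log_le_log (by exact_mod_cast hMpos) (by exact_mod_cast hM)
          linarith
  have hGtriv : ∀ {M : ℕ}, M ≤ Y → |∑ n ∈ ((Icc 1 M).filter (fun n => Squarefree n ∧ ∀ q ∈ n.primeFactors, N ≤ q)), (μ n : ℝ) * gν n| ≤ K₃ * t := by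
    intro M hM
    refine (Finset.abs_sum_le_sum_abs _ _).trans (le_trans ?_ (hSg hM))
    refine Finset.sum_le_sum fun n hn => ?_
    have hsq := (Finset.mem_filter.mp hn).2.1
    have h0 : 0 ≤ gν n := by
      rw [hgν_apply]; split_ifs
      · exact ArithmeticFunction.IsMultiplicative.nonneg_of_squarefree hg hg0 hsq
      · exact le_rfl
    rw [abs_mul, ArithmeticFunction.moebius_apply_of_squarefree hsq]
    push_cast
    rw [abs_pow, abs_neg, abs_one, one_pow, one_mul, abs_of_nonneg h0]
  -- Step 5: comparison `|G(M)| ≤ |F(M)| + hval (1+t) K₃ t` for `M ≤ Y`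
  have hcomp : ∀ {M : ℕ}, M ≤ Y →
      |∑ n ∈ ((Icc 1 M).filter (fun n => Squarefree n ∧ ∀ q ∈ n.primeFactors, N ≤ q)), (μ n : ℝ) * gν n| ≤
        |∑ n ∈ ((Icc 1 M).filter (fun n => Squarefree n ∧ ∀ q ∈ n.primeFactors, N ≤ q)), (μ n : ℝ) * fi n| + hval * (1 + t) * (K₃ * t) := by
    intro M hM
    have h := FIComparison.abs_sum_moebius_mul_sub_le hfim hgνm hfi0 hgν0 hprimes M N le_rfl
    rw [Finset.sum_sub_distrib] at h
    have hb : hval * (∑ n ∈ (Icc 1 M).filter Squarefree, fi n) * ∑ n ∈ ((Icc 1 M).filter (fun n => Squarefree n ∧ ∀ q ∈ n.primeFactors, N ≤ q)), gν n ≤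
        hval * (1 + t) * (K₃ * t) := by
      have h1 : 0 ≤ ∑ n ∈ ((Icc 1 M).filter (fun n => Squarefree n ∧ ∀ q ∈ n.primeFactors, N ≤ q)), gν n := Finset.sum_nonneg fun n hn => by
        rw [hgν_apply]; split_ifs
        · exact ArithmeticFunction.IsMultiplicative.nonneg_of_squarefree hg hg0
            (Finset.mem_filter.mp hn).2.1
        · exact le_rfl
      have h2 : 0 ≤ ∑ n ∈ (Icc 1 M).filter Squarefree, fi n :=
        Finset.sum_nonneg fun n _ => by rw [hfi_apply]; positivity
      calc hval * (∑ n ∈ (Icc 1 M).filter Squarefree, fi n) * ∑ n ∈ ((Icc 1 M).filter (fun n => Squarefree n ∧ ∀ q ∈ n.primeFactors, N ≤ q)), gν n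
          ≤ hval * (1 + t) * ∑ n ∈ ((Icc 1 M).filter (fun n => Squarefree n ∧ ∀ q ∈ n.primeFactors, N ≤ q)), gν n := by
            refine mul_le_mul_of_nonneg_right ?_ h1
            exact mul_le_mul_of_nonneg_left (hSf hM) hhval0
        _ ≤ hval * (1 + t) * (K₃ * t) :=
            mul_le_mul_of_nonneg_left (hSg hM) (by positivity)
    have habs : |∑ n ∈ ((Icc 1 M).filter (fun n => Squarefree n ∧ ∀ q ∈ n.primeFactors, N ≤ q)), (μ n : ℝ) * gν n| ≤ |∑ n ∈ ((Icc 1 M).filter (fun n => Squarefree n ∧ ∀ q ∈ n.primeFactors, N ≤ q)), (μ n : ℝ) * fi n| +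
        |∑ n ∈ ((Icc 1 M).filter (fun n => Squarefree n ∧ ∀ q ∈ n.primeFactors, N ≤ q)), (μ n : ℝ) * fi n - ∑ n ∈ ((Icc 1 M).filter (fun n => Squarefree n ∧ ∀ q ∈ n.primeFactors, N ≤ q)), (μ n : ℝ) * gν n| := by
      have := abs_sub_abs_le_abs_sub (∑ n ∈ ((Icc 1 M).filter (fun n => Squarefree n ∧ ∀ q ∈ n.primeFactors, N ≤ q)), (μ n : ℝ) * fi n)
        (∑ n ∈ ((Icc 1 M).filter (fun n => Squarefree n ∧ ∀ q ∈ n.primeFactors, N ≤ q)), (μ n : ℝ) * gν n)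
      rw [abs_sub_comm] at this
      have := abs_sub_abs_le_abs_sub (∑ n ∈ ((Icc 1 M).filter (fun n => Squarefree n ∧ ∀ q ∈ n.primeFactors, N ≤ q)), (μ n : ℝ) * gν n)
        (∑ n ∈ ((Icc 1 M).filter (fun n => Squarefree n ∧ ∀ q ∈ n.primeFactors, N ≤ q)), (μ n : ℝ) * fi n)
      rw [abs_sub_comm] at this
      linarith
    linarith
  -- Step 6: the bound for `F(Y/m)` when `m² ≤ y`
  have hFb : ∀ {m : ℕ}, 1 ≤ m → (m : ℝ) ^ 2 ≤ y →
      |∑ n ∈ ((Icc 1 (Y / m)).filter (fun n => Squarefree n ∧ ∀ q ∈ n.primeFactors, N ≤ q)), (μ n : ℝ) * fi n| ≤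
        (C + 1) * Real.exp (c + 5) * Real.log N * Real.exp (-(c / 2) * Real.sqrt (t / 2)) +
          (C + 1) * (Real.exp 5 * Real.log N) ^ 12 * Real.exp (-(t / (4 * Real.log N))) := by
    intro m hm1 hm2
    have hm0 : (0 : ℝ) < m := by exact_mod_cast hm1
    -- `w = y/m ≥ √y ≥ 2`
    have hsqy : 2 ≤ Real.sqrt y := by
      rw [show (2 : ℝ) = Real.sqrt 4 by
        rw [show (4 : ℝ) = 2 ^ 2 by norm_num, Real.sqrt_sq (by norm_num)]]
      exact Real.sqrt_le_sqrt hy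
    have hmsq : (m : ℝ) ≤ Real.sqrt y := Real.le_sqrt_of_sq_le hm2
    have hwsq : Real.sqrt y ≤ y / m := by
      rw [le_div_iff₀ hm0]
      calc Real.sqrt y * m ≤ Real.sqrt y * Real.sqrt y :=
            mul_le_mul_of_nonneg_left hmsq (Real.sqrt_nonneg y)
        _ = y := Real.mul_self_sqrt hy0.le
    have hw2 : 2 ≤ y / m := hsqy.trans hwsq
    have hfloor : ⌊y / m⌋₊ = Y / m := by rw [hY]; exact Nat.floor_div_natCast y m
    have hF := MoebiusRough.abs_sum_coprime_moebius_div_le hc hC hm hw2 hN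
    rw [hfloor, ← hP] at hF
    rw [← hF_eq (Y / m)]
    refine hF.trans ?_
    -- compare the exponentials using `log(y/m) ≥ t/2`
    have hlogw : t / 2 ≤ Real.log (y / m) := by
      have : Real.log (Real.sqrt y) = t / 2 := by rw [Real.log_sqrt hy0.le, ht]
      rw [← this]
      exact Real.log_le_log (by linarith) hwsq
    have e1 : Real.exp (-(c / 2) * Real.sqrt (Real.log (y / m))) ≤
        Real.exp (-(c / 2) * Real.sqrt (t / 2)) := by
      rw [Real.exp_le_exp]
      have := Real.sqrt_le_sqrt hlogw
      nlinarith
    have e2 : Real.exp (-(Real.log (y / m) / (2 * Real.log N))) ≤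
        Real.exp (-(t / (4 * Real.log N))) := by
      rw [Real.exp_le_exp, neg_le_neg_iff, div_le_div_iff₀ (by positivity) (by positivity)]
      nlinarith
    gcongr
  -- Step 7: assemble
  obtain ⟨Bsmall, hBsmall⟩ : ∃ B : ℝ, B =
    (C + 1) * Real.exp (c + 5) * Real.log N * Real.exp (-(c / 2) * Real.sqrt (t / 2)) +
      (C + 1) * (Real.exp 5 * Real.log N) ^ 12 * Real.exp (-(t / (4 * Real.log N))) +
      hval * (1 + t) * (K₃ * t) := ⟨_, rfl⟩
  have hBsmall0 : 0 ≤ Bsmall := by rw [hBsmall]; positivity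
  have hKt0 : 0 ≤ K₃ * t := mul_nonneg hK₃0 ht0.le
  -- termwise bound: `|A m| |G(Y/m)| ≤ [m sqf] g(m) B(m)`
  have hterm : ∀ m ∈ (Icc 1 Y).filter (· ∈ N.smoothNumbers),
      |A m * ∑ n ∈ (Icc 1 (Y / m)).filter (fun n => n.Coprime P), A n| ≤
        (if Squarefree m then g m else 0) *
          (if (m : ℝ) ^ 2 ≤ y then Bsmall else K₃ * t) := by
    intro m hm
    obtain ⟨hmI, hms⟩ := Finset.mem_filter.mp hm
    obtain ⟨hm1, hmY⟩ := Finset.mem_Icc.mp hmI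
    have hMY : Y / m ≤ Y := Nat.div_le_self Y m
    rw [hG_eq, abs_mul]
    by_cases hsq : Squarefree m
    · rw [if_pos hsq]
      have hgνm0 : 0 ≤ gν m := by
        rw [hgν_apply]; split_ifs
        · exact ArithmeticFunction.IsMultiplicative.nonneg_of_squarefree hg hg0 hsq
        · exact le_rfl
      have hAm_le : |A m| ≤ g m := by
        rw [hA_eq, abs_mul, ArithmeticFunction.moebius_apply_of_squarefree hsq]
        push_cast
        rw [abs_pow, abs_neg, abs_one, one_pow, one_mul, abs_of_nonneg hgνm0]
        exact hgν_le m hsq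
      have hgm : 0 ≤ g m := ArithmeticFunction.IsMultiplicative.nonneg_of_squarefree hg hg0 hsq
      refine mul_le_mul hAm_le ?_ (abs_nonneg _) hgm
      split_ifs with hm2
      · calc |∑ n ∈ ((Icc 1 (Y / m)).filter (fun n => Squarefree n ∧ ∀ q ∈ n.primeFactors, N ≤ q)), (μ n : ℝ) * gν n|
            ≤ |∑ n ∈ ((Icc 1 (Y / m)).filter (fun n => Squarefree n ∧ ∀ q ∈ n.primeFactors, N ≤ q)), (μ n : ℝ) * fi n| + hval * (1 + t) * (K₃ * t) := hcomp hMY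
          _ ≤ _ := by rw [hBsmall]; linarith [hFb hm1 hm2]
      · exact hGtriv hMY
    · rw [if_neg hsq, zero_mul]
      have : A m = 0 := by
        rw [hA_eq, ArithmeticFunction.moebius_eq_zero_of_not_squarefree hsq]; simp
      rw [this, abs_zero, zero_mul]
  -- sum the termwise bound and pass to the divisors of `P`
  have hsum1 : |∑ d ∈ Icc 1 Y, A d| ≤
      ∑ m ∈ P.divisors, g m * (if (m : ℝ) ^ 2 ≤ y then Bsmall else K₃ * t) := by
    rw [hstep1]
    refine (Finset.abs_sum_le_sum_abs _ _).trans ((Finset.sum_le_sum hterm).trans ?_)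
    simp_rw [ite_mul, zero_mul]
    rw [← Finset.sum_filter]
    refine Finset.sum_le_sum_of_subset_of_nonneg ?_ fun m hm _ => ?_
    · intro m hm
      obtain ⟨hm', hsq⟩ := Finset.mem_filter.mp hm
      obtain ⟨hmI, hms⟩ := Finset.mem_filter.mp hm'
      have hP0 : P ≠ 0 := by
        rw [hP]
        exact Finset.prod_ne_zero_iff.mpr fun p hp => (Nat.prime_of_mem_primesBelow hp).ne_zero
      exact Nat.mem_divisors.mpr ⟨hP ▸ dvd_prod_primesBelow_of_smooth hsq hms, hP0⟩
    · have hmsq : Squarefree m := (squarefree_primesProdBelow (N : ℝ)).squarefree_of_dvd (by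
        rw [primesProdBelow, Nat.ceil_natCast, ← hP]; exact Nat.dvd_of_mem_divisors hm)
      refine mul_nonneg (ArithmeticFunction.IsMultiplicative.nonneg_of_squarefree hg hg0 hmsq) ?_
      split_ifs
      · exact hBsmall0
      · exact hKt0
  -- split the divisor sum at `m² ≤ y`
  have hsum2 : ∑ m ∈ P.divisors, g m * (if (m : ℝ) ^ 2 ≤ y then Bsmall else K₃ * t) ≤
      (∑ m ∈ P.divisors, g m) * Bsmall +
        K₃ * t * ∑ m ∈ P.divisors.filter (fun m : ℕ => y < (m : ℝ) ^ 2), g m := by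
    rw [← Finset.sum_filter_add_sum_filter_not P.divisors (fun m : ℕ => (m : ℝ) ^ 2 ≤ y)]
    have e1 : ∑ m ∈ P.divisors.filter (fun m : ℕ => (m : ℝ) ^ 2 ≤ y),
        g m * (if (m : ℝ) ^ 2 ≤ y then Bsmall else K₃ * t) =
        (∑ m ∈ P.divisors.filter (fun m : ℕ => (m : ℝ) ^ 2 ≤ y), g m) * Bsmall := by
      rw [Finset.sum_mul]
      refine Finset.sum_congr rfl fun m hm => ?_
      rw [if_pos (Finset.mem_filter.mp hm).2]
    have e2 : ∑ m ∈ P.divisors.filter (fun m : ℕ => ¬(m : ℝ) ^ 2 ≤ y),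
        g m * (if (m : ℝ) ^ 2 ≤ y then Bsmall else K₃ * t) =
        K₃ * t * ∑ m ∈ P.divisors.filter (fun m : ℕ => y < (m : ℝ) ^ 2), g m := by
      rw [Finset.mul_sum]
      have hs : P.divisors.filter (fun m : ℕ => ¬(m : ℝ) ^ 2 ≤ y) =
          P.divisors.filter (fun m : ℕ => y < (m : ℝ) ^ 2) := by
        refine Finset.filter_congr fun m _ => ?_
        exact not_le
      rw [hs]
      refine Finset.sum_congr rfl fun m hm => ?_
      rw [if_neg (not_le.mpr (Finset.mem_filter.mp hm).2), mul_comm]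
    rw [e1, e2]
    have hgP : ∀ m ∈ P.divisors, 0 ≤ g m := fun m hm =>
      ArithmeticFunction.IsMultiplicative.nonneg_of_squarefree hg hg0
        ((squarefree_primesProdBelow (N : ℝ)).squarefree_of_dvd (by
          rw [primesProdBelow, Nat.ceil_natCast, ← hP]; exact Nat.dvd_of_mem_divisors hm))
    have : (∑ m ∈ P.divisors.filter (fun m : ℕ => (m : ℝ) ^ 2 ≤ y), g m) ≤ ∑ m ∈ P.divisors, g m :=
      Finset.sum_le_sum_of_subset_of_nonneg (Finset.filter_subset _ _) fun m hm _ => hgP m hm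
    exact add_le_add (mul_le_mul_of_nonneg_right this hBsmall0) le_rfl
  -- evaluate `∑_{m ∣ P} g(m) = ∏ (1 + g p)` and bound the tail by Rankin
  have hdivsum : ∑ m ∈ P.divisors, g m = ∏ p ∈ N.primesBelow, (1 + g p) := by
    rw [hP]; exact sum_divisors_prod_primesBelow_eq hg N
  have htail := sum_divisors_tail_le hg hg0 hy0 hN3
  rw [← hP, ← ht] at htail
  have hprod0 : 0 ≤ ∏ p ∈ N.primesBelow, (1 + g p) :=
    Finset.prod_nonneg fun p hp => by linarith [hg0 p (Nat.prime_of_mem_primesBelow hp)]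
  -- conclude
  rw [hstep0]
  calc |∑ d ∈ Icc 1 Y, A d|
      ≤ (∑ m ∈ P.divisors, g m) * Bsmall +
          K₃ * t * ∑ m ∈ P.divisors.filter (fun m : ℕ => y < (m : ℝ) ^ 2), g m := hsum1.trans hsum2
    _ ≤ (∏ p ∈ N.primesBelow, (1 + g p)) * Bsmall +
          K₃ * t * (Real.exp (-(t / Real.log N)) * ∏ p ∈ N.primesBelow, (1 + 8 * g p)) := by
        rw [hdivsum]
        exact add_le_add le_rfl (mul_le_mul_of_nonneg_left htail hKt0)
    _ = _ := by rw [hBsmall]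

end FICancellation

end Literature.NumberTheory.Sieve


namespace Literature.NumberTheory.Sieve

namespace FICancellation

open Finset Real
open scoped ArithmeticFunction.Moebius ArithmeticFunction.zeta

/-! ### Numerical bookkeeping: the structural bound is `≪ σ_ν (log y)^{-6}` -/

set_option maxHeartbeats 400000 in
/-- **Pure real-variable bookkeeping** for the choice `log z = log y (log log y)^{-2}` (FI p. 1049:
"We choose `log z = (log y)(log log y)^{-2}` obtaining (2.4)"). With `t = log y = e^u`, `u ≥ 9`,
`LN = log N ∈ [t/u², 2t/u²]`, `LN1 = log(N-1) ≥ t/(2u²)`, `1/√N ≤ 20^{10}/LN^{10}`,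
`P₁ = ∏(1+g(p)) ≤ K₃ LN`, `P₈ = ∏(1+8g(p)) ≤ K₃⁸ LN⁸`, the structural bound is at most
`K σ/t⁶` for an explicit `K`. [cite: FriedlanderIwaniecASP1998, §2 p. 1049] -/
theorem numerics {t u LN LN1 sN P₁ P₈ σ K₃ C c Kf K₂ K₁ : ℝ}
    (hu : 9 ≤ u) (ht : t = Real.exp u) (hK₃ : 1 ≤ K₃) (hC : 0 ≤ C) (hc : 0 < c) (hK₁ : 0 ≤ K₁)
    (hσ : 1 ≤ σ) (hLN : t / u ^ 2 ≤ LN) (hLN' : LN ≤ 2 * t / u ^ 2) (hLN1 : t / (2 * u ^ 2) ≤ LN1)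
    (hsN0 : 0 < sN) (hsN : sN⁻¹ ≤ 20 ^ 10 / LN ^ 10)
    (hP₁ : P₁ ≤ K₃ * LN) (hP₈0 : 0 ≤ P₈) (hP₈ : P₈ ≤ K₃ ^ 8 * LN ^ 8) :
    P₁ * ((C + 1) * Real.exp (c + 5) * LN * Real.exp (-(c / 2) * Real.sqrt (t / 2)) +
          (C + 1) * (Real.exp 5 * LN) ^ 12 * Real.exp (-(t / (4 * LN))) +
          (2 * (|Kf| + |K₂|) / LN1 ^ 10 + K₁ * σ / sN) * (1 + t) * (K₃ * t)) +
      K₃ * t * (Real.exp (-(t / LN)) * P₈) ≤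
    (K₃ * (C + 1) * Real.exp (c + 5) * (Nat.factorial 16) * (4 / c) ^ 16 +
      K₃ * (C + 1) * Real.exp 60 * Real.exp 722 +
      2 * K₃ ^ 2 * (2 ^ 11 * (|Kf| + |K₂|) + 20 ^ 10 * K₁) * 20 ^ 20 +
      K₃ ^ 9 * Real.exp 113) * σ / t ^ 6 := by
  -- basic facts about `u`, `t`
  have hu0 : 0 < u := by linarith
  have hu2 : 81 ≤ u ^ 2 := by nlinarith
  have ht0 : 0 < t := by rw [ht]; exact Real.exp_pos u
  have htu : u ^ 4 / 24 ≤ t := by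
    have := Real.pow_div_factorial_le_exp u hu0.le 4
    rw [ht]; simpa [Nat.factorial] using this
  have htu2 : 3 * u ^ 2 ≤ t := by nlinarith
  have ht3 : 3 ≤ t / u ^ 2 := by rw [le_div_iff₀ (by positivity)]; linarith
  have hLN3 : 3 ≤ LN := ht3.trans hLN
  have hLN0 : 0 < LN := by linarith
  have hLNt : LN ≤ t := by
    refine hLN'.trans ?_
    rw [div_le_iff₀ (by positivity)]; nlinarith
  have hLN10 : 0 < LN1 := by
    have : 0 < t / (2 * u ^ 2) := by positivity
    linarith
  have ht1 : 1 ≤ t := by linarith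
  have hlogt : Real.log t = u := by rw [ht, Real.log_exp]
  have hK₃0 : 0 ≤ K₃ := by linarith
  have hσ0 : 0 ≤ σ := by linarith
  -- `exp(-6u) = 1/t^6` and `t^k = exp(k u)`
  have htpow : ∀ k : ℕ, t ^ k = Real.exp (k * u) := fun k => by rw [ht, ← Real.exp_nat_mul]
  have hinv6 : Real.exp (-(6 * u)) = (t ^ 6)⁻¹ := by
    rw [htpow 6, ← Real.exp_neg]; norm_num
  -- `u^20 ≤ 20^20 t`
  have hu20 : u ^ 20 ≤ 20 ^ 20 * t := by rw [← hlogt]; exact log_pow_twenty_le ht1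
  ------------------------------------------------------------------
  -- T1
  have hT1 : P₁ * ((C + 1) * Real.exp (c + 5) * LN * Real.exp (-(c / 2) * Real.sqrt (t / 2))) ≤
      K₃ * (C + 1) * Real.exp (c + 5) * (Nat.factorial 16) * (4 / c) ^ 16 / t ^ 6 := by
    have hE : Real.exp (-(c / 2) * Real.sqrt (t / 2)) ≤ (Nat.factorial 16 : ℝ) / ((c / 4) ^ 16 * t ^ 8) := by
      have hsq : Real.sqrt t / 2 ≤ Real.sqrt (t / 2) := by
        refine Real.le_sqrt_of_sq_le ?_
        rw [div_pow, Real.sq_sqrt ht0.le]; linarith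
      calc Real.exp (-(c / 2) * Real.sqrt (t / 2)) ≤ Real.exp (-(c / 4 * Real.sqrt t)) := by
            rw [Real.exp_le_exp]; nlinarith
        _ ≤ (Nat.factorial 16 : ℝ) / ((c / 4) ^ 16 * t ^ 8) := exp_neg_mul_sqrt_le (by positivity) ht0
    calc P₁ * ((C + 1) * Real.exp (c + 5) * LN * Real.exp (-(c / 2) * Real.sqrt (t / 2)))
        ≤ (K₃ * t) * ((C + 1) * Real.exp (c + 5) * t *
            ((Nat.factorial 16 : ℝ) / ((c / 4) ^ 16 * t ^ 8))) := by
          refine mul_le_mul (hP₁.trans (mul_le_mul_of_nonneg_left hLNt hK₃0)) ?_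
            (by positivity) (by positivity)
          exact mul_le_mul (mul_le_mul_of_nonneg_left hLNt (by positivity)) hE (by positivity)
            (by positivity)
      _ = K₃ * (C + 1) * Real.exp (c + 5) * (Nat.factorial 16) * (4 / c) ^ 16 / t ^ 6 := by
          field_simp
  ------------------------------------------------------------------
  -- T2
  have hT2 : P₁ * ((C + 1) * (Real.exp 5 * LN) ^ 12 * Real.exp (-(t / (4 * LN)))) ≤
      K₃ * (C + 1) * Real.exp 60 * Real.exp 722 / t ^ 6 := by
    have hE : Real.exp (-(t / (4 * LN))) ≤ Real.exp (-(u ^ 2 / 8)) := by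
      have h2t : LN * u ^ 2 ≤ 2 * t := (le_div_iff₀ (by positivity : (0 : ℝ) < u ^ 2)).mp hLN'
      have : u ^ 2 / 8 ≤ t / (4 * LN) := by
        rw [le_div_iff₀ (by positivity)]
        linarith
      exact Real.exp_le_exp.mpr (neg_le_neg this)
    have hLN12 : (Real.exp 5 * LN) ^ 12 ≤ Real.exp 60 * t ^ 12 := by
      rw [mul_pow, ← Real.exp_nat_mul]; norm_num
      exact mul_le_mul_of_nonneg_left (pow_le_pow_left₀ hLN0.le hLNt 12) (Real.exp_pos _).le
    have hmain : t * t ^ 12 * Real.exp (-(u ^ 2 / 8)) ≤ Real.exp 722 / t ^ 6 := by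
      rw [show t * t ^ 12 = t ^ 13 by ring, htpow 13, ← Real.exp_add,
        div_eq_mul_inv (Real.exp 722) (t ^ 6), ← hinv6, ← Real.exp_add, Real.exp_le_exp]
      have := exp_linear_sub_sq_le 19 u (b := 8) (by norm_num)
      rw [Real.exp_le_exp] at this
      norm_num at this ⊢
      linarith
    calc P₁ * ((C + 1) * (Real.exp 5 * LN) ^ 12 * Real.exp (-(t / (4 * LN))))
        ≤ (K₃ * t) * ((C + 1) * (Real.exp 60 * t ^ 12) * Real.exp (-(u ^ 2 / 8))) := by
          refine mul_le_mul (hP₁.trans (mul_le_mul_of_nonneg_left hLNt hK₃0)) ?_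
            (by positivity) (by positivity)
          exact mul_le_mul (mul_le_mul_of_nonneg_left hLN12 (by positivity)) hE (by positivity)
            (by positivity)
      _ = K₃ * (C + 1) * Real.exp 60 * (t * t ^ 12 * Real.exp (-(u ^ 2 / 8))) := by ring
      _ ≤ K₃ * (C + 1) * Real.exp 60 * (Real.exp 722 / t ^ 6) :=
          mul_le_mul_of_nonneg_left hmain (by positivity)
      _ = K₃ * (C + 1) * Real.exp 60 * Real.exp 722 / t ^ 6 := by ring
  ------------------------------------------------------------------
  -- T3
  have hT3 : P₁ * ((2 * (|Kf| + |K₂|) / LN1 ^ 10 + K₁ * σ / sN) * (1 + t) * (K₃ * t)) ≤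
      2 * K₃ ^ 2 * (2 ^ 11 * (|Kf| + |K₂|) + 20 ^ 10 * K₁) * 20 ^ 20 * σ / t ^ 6 := by
    -- the `h`-value
    have hh1 : 2 * (|Kf| + |K₂|) / LN1 ^ 10 ≤ 2 * (|Kf| + |K₂|) * (2 ^ 10 * u ^ 20 / t ^ 10) := by
      rw [div_eq_mul_inv]
      refine mul_le_mul_of_nonneg_left ?_ (by positivity)
      rw [inv_le_comm₀ (by positivity) (by positivity), inv_div]
      calc t ^ 10 / (2 ^ 10 * u ^ 20) = (t / (2 * u ^ 2)) ^ 10 := by ring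
        _ ≤ LN1 ^ 10 := pow_le_pow_left₀ (by positivity) hLN1 10
    have hh2 : K₁ * σ / sN ≤ K₁ * σ * (20 ^ 10 * (u ^ 20 / t ^ 10)) := by
      rw [div_eq_mul_inv]
      refine mul_le_mul_of_nonneg_left (hsN.trans ?_) (by positivity)
      rw [div_eq_mul_inv]
      refine mul_le_mul_of_nonneg_left ?_ (by positivity)
      rw [inv_le_comm₀ (by positivity) (by positivity), inv_div]
      calc t ^ 10 / u ^ 20 = (t / u ^ 2) ^ 10 := by ring
        _ ≤ LN ^ 10 := pow_le_pow_left₀ (by positivity) hLN 10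
    have hh : 2 * (|Kf| + |K₂|) / LN1 ^ 10 + K₁ * σ / sN ≤
        (2 ^ 11 * (|Kf| + |K₂|) + 20 ^ 10 * K₁) * σ * (u ^ 20 / t ^ 10) := by
      have e : 2 * (|Kf| + |K₂|) * (2 ^ 10 * u ^ 20 / t ^ 10) + K₁ * σ * (20 ^ 10 * (u ^ 20 / t ^ 10))
          = (2 ^ 11 * (|Kf| + |K₂|) + 20 ^ 10 * K₁ * σ) * (u ^ 20 / t ^ 10) := by ring
      refine (add_le_add hh1 hh2).trans ?_
      rw [e]
      refine mul_le_mul_of_nonneg_right ?_ (by positivity)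
      have : 2 ^ 11 * (|Kf| + |K₂|) ≤ 2 ^ 11 * (|Kf| + |K₂|) * σ :=
        le_mul_of_one_le_right (by positivity) hσ
      nlinarith
    have hh0 : 0 ≤ 2 * (|Kf| + |K₂|) / LN1 ^ 10 + K₁ * σ / sN := by positivity
    calc P₁ * ((2 * (|Kf| + |K₂|) / LN1 ^ 10 + K₁ * σ / sN) * (1 + t) * (K₃ * t))
        ≤ (K₃ * t) * (((2 ^ 11 * (|Kf| + |K₂|) + 20 ^ 10 * K₁) * σ * (u ^ 20 / t ^ 10)) *
            (2 * t) * (K₃ * t)) := by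
          refine mul_le_mul (hP₁.trans (mul_le_mul_of_nonneg_left hLNt hK₃0)) ?_
            (by positivity) (by positivity)
          refine mul_le_mul_of_nonneg_right ?_ (by positivity)
          exact mul_le_mul hh (by linarith) (by positivity) (by positivity)
      _ = 2 * K₃ ^ 2 * (2 ^ 11 * (|Kf| + |K₂|) + 20 ^ 10 * K₁) * σ * u ^ 20 / t ^ 7 := by
          field_simp
      _ ≤ 2 * K₃ ^ 2 * (2 ^ 11 * (|Kf| + |K₂|) + 20 ^ 10 * K₁) * σ * (20 ^ 20 * t) / t ^ 7 := by
          gcongr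
      _ = 2 * K₃ ^ 2 * (2 ^ 11 * (|Kf| + |K₂|) + 20 ^ 10 * K₁) * 20 ^ 20 * σ / t ^ 6 := by
          field_simp
  ------------------------------------------------------------------
  -- T4
  have hT4 : K₃ * t * (Real.exp (-(t / LN)) * P₈) ≤ K₃ ^ 9 * Real.exp 113 / t ^ 6 := by
    have hE : Real.exp (-(t / LN)) ≤ Real.exp (-(u ^ 2 / 2)) := by
      have h2t : LN * u ^ 2 ≤ 2 * t := (le_div_iff₀ (by positivity : (0 : ℝ) < u ^ 2)).mp hLN'
      have : u ^ 2 / 2 ≤ t / LN := by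
        rw [le_div_iff₀ hLN0]
        linarith
      exact Real.exp_le_exp.mpr (neg_le_neg this)
    have hP8t : P₈ ≤ K₃ ^ 8 * t ^ 8 := by
      have h1 : LN ^ 8 ≤ t ^ 8 := pow_le_pow_left₀ hLN0.le hLNt 8
      have h2 : 0 ≤ K₃ ^ 8 := pow_nonneg hK₃0 8
      exact hP₈.trans (mul_le_mul_of_nonneg_left h1 h2)
    have hmain : t * t ^ 8 * Real.exp (-(u ^ 2 / 2)) ≤ Real.exp 113 / t ^ 6 := by
      rw [show t * t ^ 8 = t ^ 9 by ring, htpow 9, ← Real.exp_add,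
        div_eq_mul_inv (Real.exp 113) (t ^ 6), ← hinv6, ← Real.exp_add, Real.exp_le_exp]
      have := exp_linear_sub_sq_le 15 u (b := 2) (by norm_num)
      rw [Real.exp_le_exp] at this
      norm_num at this ⊢
      linarith
    calc K₃ * t * (Real.exp (-(t / LN)) * P₈)
        ≤ K₃ * t * (Real.exp (-(u ^ 2 / 2)) * (K₃ ^ 8 * t ^ 8)) := by
          refine mul_le_mul_of_nonneg_left ?_ (by positivity)
          exact mul_le_mul hE hP8t hP₈0 (by positivity)
      _ = K₃ ^ 9 * (t * t ^ 8 * Real.exp (-(u ^ 2 / 2))) := by ring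
      _ ≤ K₃ ^ 9 * (Real.exp 113 / t ^ 6) := mul_le_mul_of_nonneg_left hmain (by positivity)
      _ = K₃ ^ 9 * Real.exp 113 / t ^ 6 := by ring
  ------------------------------------------------------------------
  -- sum up (`σ ≥ 1`)
  have hLHS : P₁ * ((C + 1) * Real.exp (c + 5) * LN * Real.exp (-(c / 2) * Real.sqrt (t / 2)) +
          (C + 1) * (Real.exp 5 * LN) ^ 12 * Real.exp (-(t / (4 * LN))) +
          (2 * (|Kf| + |K₂|) / LN1 ^ 10 + K₁ * σ / sN) * (1 + t) * (K₃ * t)) +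
      K₃ * t * (Real.exp (-(t / LN)) * P₈) =
      P₁ * ((C + 1) * Real.exp (c + 5) * LN * Real.exp (-(c / 2) * Real.sqrt (t / 2))) +
        P₁ * ((C + 1) * (Real.exp 5 * LN) ^ 12 * Real.exp (-(t / (4 * LN)))) +
        P₁ * ((2 * (|Kf| + |K₂|) / LN1 ^ 10 + K₁ * σ / sN) * (1 + t) * (K₃ * t)) +
        K₃ * t * (Real.exp (-(t / LN)) * P₈) := by
    rw [mul_add, mul_add]
  rw [hLHS]
  refine (add_le_add (add_le_add (add_le_add hT1 hT2) hT3) hT4).trans ?_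
  rw [← add_div, ← add_div, ← add_div]
  refine div_le_div_of_nonneg_right ?_ (by positivity)
  have hA1 : 0 ≤ K₃ * (C + 1) * Real.exp (c + 5) * (Nat.factorial 16) * (4 / c) ^ 16 := by
    positivity
  have hA2 : 0 ≤ K₃ * (C + 1) * Real.exp 60 * Real.exp 722 := by positivity
  have hA4 : 0 ≤ K₃ ^ 9 * Real.exp 113 := by positivity
  have h1 : K₃ * (C + 1) * Real.exp (c + 5) * (Nat.factorial 16) * (4 / c) ^ 16 ≤
      K₃ * (C + 1) * Real.exp (c + 5) * (Nat.factorial 16) * (4 / c) ^ 16 * σ :=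
    le_mul_of_one_le_right hA1 hσ
  have h2 : K₃ * (C + 1) * Real.exp 60 * Real.exp 722 ≤ K₃ * (C + 1) * Real.exp 60 * Real.exp 722 * σ :=
    le_mul_of_one_le_right hA2 hσ
  have h4 : K₃ ^ 9 * Real.exp 113 ≤ K₃ ^ 9 * Real.exp 113 * σ := le_mul_of_one_le_right hA4 hσ
  linarith

end FICancellation

end Literature.NumberTheory.Sieve


namespace Literature.NumberTheory.Sieve

open Finset Real
open scoped ArithmeticFunction.Moebius ArithmeticFunction.zeta

/-! ### The Möbius–density cancellation (2.4) -/

/-- **Friedlander–Iwaniec (2.4)–(2.5), PROVED**: under (1.8) and (1.9),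
`∑_{d ≤ y, (d, ν) = 1} μ(d) g(d) ≪ σ_ν (log y)^{-6}` uniformly in `ν ≥ 1`, `y ≥ 2`. This discharges
the named fact `Literature.NumberTheory.Sieve.fi_moebius_density_cancellation` (`AsymptoticSieveForPrimesInputs.lean`).
The proof is FI's (pp. 1048–1049): smooth–rough splitting at `z` with
`log z = log y (log log y)^{-2}`, Rankin's trick for the smooth tail, comparison of
`g(n)[(n, ν) = 1]` with `f(n) = 1/n` on the rough part (`FIComparison.abs_sum_moebius_mul_sub_le`,
with `h(z) = 2(|K_f| + |K₂|)(log(N-1))^{-10} + K₁ σ_ν N^{-1/2}`, `N = ⌈z⌉`, from (1.9) for `g`, the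
PROVED (1.9) for `1/p` (`Literature.NumberTheory.LFunctions.Mertens.exists_sum_primesLE_inv_loglog`) and
`∑_{p ∣ ν, p ≥ N} p⁻¹ ≤ σ_ν/√N`), and the bound for `F(w, z)`
(`MoebiusRough.abs_sum_coprime_moebius_div_le`, from the PROVED `∑_{k ≤ x} μ(k)/k ≪ e^{-c√log x}`
in place of FI's contour integration); small `y` (`log log y < 9`) are covered by the trivial bound
`∑♭_{d ≤ y} g(d) ≪ log y`. [cite: FriedlanderIwaniecASP1998, §2 (2.4)-(2.5)] -/
theorem fi_moebius_density_cancellation_holds : fi_moebius_density_cancellation := by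
  intro g hg h18 h19
  classical
  obtain ⟨K₁', hK₁'⟩ := h18
  obtain ⟨c₁, K₂, h19'⟩ := h19
  obtain ⟨K₁, hK₁0, h18'⟩ : ∃ K : ℝ, 0 ≤ K ∧ ∀ p : ℕ, p.Prime → 0 ≤ g p ∧ g p < 1 ∧ g p ≤ K / p :=
    ⟨max K₁' 0, le_max_right _ _, fun p hp => ⟨(hK₁' p hp).1, (hK₁' p hp).2.1,
      (hK₁' p hp).2.2.trans (div_le_div_of_nonneg_right (le_max_left _ _) (Nat.cast_nonneg _))⟩⟩
  obtain ⟨cf, Kf, h19f⟩ := Literature.NumberTheory.LFunctions.Mertens.exists_sum_primesLE_inv_loglog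
  obtain ⟨c, hc, C', hm'⟩ := Literature.NumberTheory.LFunctions.abs_sum_moebius_div_le_exp_neg_sqrt_log
  obtain ⟨C, hC0, hm⟩ : ∃ C : ℝ, 0 ≤ C ∧ ∀ x : ℝ, 2 ≤ x →
      |∑ k ∈ Icc 1 ⌊x⌋₊, (μ k : ℝ) / k| ≤ C * Real.exp (-c * Real.sqrt (Real.log x)) :=
    ⟨max C' 0, le_max_right _ _, fun x hx => (hm' x hx).trans
      (mul_le_mul_of_nonneg_right (le_max_left _ _) (Real.exp_pos _).le)⟩
  have hg0 : ∀ p : ℕ, p.Prime → 0 ≤ g p := fun p hp => (h18' p hp).1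
  obtain ⟨K₃, hK₃⟩ : ∃ K : ℝ, K = Real.exp (|c₁| + |K₂| / Real.log 2 ^ 10) := ⟨_, rfl⟩
  have hK₃1 : 1 ≤ K₃ := by rw [hK₃]; exact Real.one_le_exp (by positivity)
  have hK₃0 : 0 ≤ K₃ := zero_le_one.trans hK₃1
  -- the two constants (the large-`y` constant is kept opaque: only its defining inequality is used)
  obtain ⟨Kev, hKev0, hKevle⟩ : ∃ K : ℝ, 0 ≤ K ∧ ∀ M : ℝ,
      K₃ * (C + 1) * Real.exp (c + 5) * (Nat.factorial 16) * (4 / c) ^ 16 +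
        K₃ * (C + 1) * Real.exp 60 * Real.exp 722 +
        2 * K₃ ^ 2 * (2 ^ 11 * (|Kf| + |K₂|) + 20 ^ 10 * K₁) * 20 ^ 20 +
        K₃ ^ 9 * Real.exp 113 ≤ max K M :=
    ⟨_, by positivity, fun M => le_max_left _ _⟩
  refine ⟨max Kev (K₃ * Real.exp 63), fun ν hν y hy => ?_⟩
  have hy0 : 0 < y := by linarith
  obtain ⟨t, ht⟩ : ∃ t : ℝ, t = Real.log y := ⟨_, rfl⟩
  have hl2 : 0 < Real.log 2 := Real.log_pos one_lt_two
  have ht2 : Real.log 2 ≤ t := by rw [ht]; exact Real.log_le_log two_pos hy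
  have ht0 : 0 < t := hl2.trans_le ht2
  have hσ1 : 1 ≤ sigmaHalf ν := one_le_sigmaHalf ν
  -- the trivial bound `|G_ν(y)| ≤ K₃ t`
  have htriv : |∑ d ∈ (Icc 1 ⌊y⌋₊).filter (fun d : ℕ => d.Coprime ν), (μ d : ℝ) * g d| ≤ K₃ * t := by
    have hY2 : 2 ≤ ⌊y⌋₊ := Nat.le_floor (by norm_num; linarith)
    refine (Finset.abs_sum_le_sum_abs _ _).trans ?_
    calc ∑ d ∈ (Icc 1 ⌊y⌋₊).filter (fun d : ℕ => d.Coprime ν), |(μ d : ℝ) * g d|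
        ≤ ∑ d ∈ Icc 1 ⌊y⌋₊, |(μ d : ℝ) * g d| :=
          Finset.sum_le_sum_of_subset_of_nonneg (Finset.filter_subset _ _) fun d _ _ => abs_nonneg _
      _ = ∑ d ∈ Icc 1 ⌊y⌋₊, if Squarefree d then g d else 0 := by
          refine Finset.sum_congr rfl fun d _ => ?_
          split_ifs with hsq
          · rw [abs_mul, ArithmeticFunction.moebius_apply_of_squarefree hsq]
            push_cast
            rw [abs_pow, abs_neg, abs_one, one_pow, one_mul,
              abs_of_nonneg (ArithmeticFunction.IsMultiplicative.nonneg_of_squarefree hg hg0 hsq)]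
          · rw [ArithmeticFunction.moebius_eq_zero_of_not_squarefree hsq]; simp
      _ = ∑ d ∈ (Icc 1 ⌊y⌋₊).filter Squarefree, g d := (Finset.sum_filter _ _).symm
      _ ≤ K₃ * Real.log (⌊y⌋₊ : ℕ) := by
          rw [hK₃]; exact FICancellation.sum_squarefree_density_le hg hg0 h19' hY2
      _ ≤ K₃ * t := by
          refine mul_le_mul_of_nonneg_left ?_ hK₃0
          rw [ht]
          exact Real.log_le_log (by exact_mod_cast (show 0 < ⌊y⌋₊ by omega)) (Nat.floor_le hy0.le)
  by_cases hlarge : 9 ≤ Real.log t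
  · ----------------------------------------------------------------
    -- large `y`: `u = log log y ≥ 9`
    obtain ⟨u, hu⟩ : ∃ u : ℝ, u = Real.log t := ⟨_, rfl⟩
    rw [← hu] at hlarge
    have htexp : t = Real.exp u := by rw [hu, Real.exp_log ht0]
    have hu0 : 0 < u := by linarith
    have hu2 : 81 ≤ u ^ 2 := by nlinarith only [hlarge]
    have htu : u ^ 4 / 24 ≤ t := by
      have := Real.pow_div_factorial_le_exp u hu0.le 4
      rw [htexp]; simpa [Nat.factorial] using this
    have ht3 : 3 ≤ t / u ^ 2 := by
      rw [le_div_iff₀ (by positivity)]; nlinarith only [hu2, htu, sq_nonneg u]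
    -- the parameter `z` and `N = ⌈z⌉`
    obtain ⟨z, hz⟩ : ∃ z : ℝ, z = Real.exp (t / u ^ 2) := ⟨_, rfl⟩
    have hz0 : 0 < z := by rw [hz]; exact Real.exp_pos _
    have hlogz : Real.log z = t / u ^ 2 := by rw [hz, Real.log_exp]
    have hz8 : 8 ≤ z := by
      rw [hz]
      calc (8 : ℝ) ≤ Real.exp 3 := by
            have h1 := Real.exp_one_gt_d9
            have : Real.exp 3 = Real.exp 1 * Real.exp 1 * Real.exp 1 := by
              rw [← Real.exp_add, ← Real.exp_add]; norm_num
            rw [this]; nlinarith [Real.exp_pos 1]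
        _ ≤ Real.exp (t / u ^ 2) := Real.exp_le_exp.mpr ht3
    obtain ⟨N, hN⟩ : ∃ N : ℕ, N = ⌈z⌉₊ := ⟨_, rfl⟩
    have hzN : z ≤ N := by rw [hN]; exact Nat.le_ceil z
    have hNz : (N : ℝ) < z + 1 := by rw [hN]; exact Nat.ceil_lt_add_one hz0.le
    have hN8r : (8 : ℝ) ≤ N := hz8.trans hzN
    have hN8 : 8 ≤ N := by exact_mod_cast hN8r
    have hN0 : (0 : ℝ) < N := by linarith
    have hlogN : t / u ^ 2 ≤ Real.log N := by
      rw [← hlogz]; exact Real.log_le_log hz0 hzN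
    have hlogN' : Real.log N ≤ 2 * t / u ^ 2 := by
      have h1 : Real.log N ≤ Real.log (2 * z) := Real.log_le_log hN0 (by linarith)
      rw [Real.log_mul two_ne_zero hz0.ne', hlogz] at h1
      have : Real.log 2 ≤ 1 := by
        rw [Real.log_le_iff_le_exp two_pos]
        have := Real.exp_one_gt_d9; linarith
      have e : 2 * t / u ^ 2 = t / u ^ 2 + t / u ^ 2 := by ring
      rw [e]; linarith only [h1, this, ht3]
    have hlogN1 : t / (2 * u ^ 2) ≤ Real.log ((N - 1 : ℕ) : ℝ) := by
      have hcast : ((N - 1 : ℕ) : ℝ) = (N : ℝ) - 1 := by rw [Nat.cast_sub (by omega)]; norm_num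
      have h1 : z / 2 ≤ (N : ℝ) - 1 := by linarith
      have h2 : Real.log (z / 2) ≤ Real.log ((N - 1 : ℕ) : ℝ) := by
        rw [hcast]; exact Real.log_le_log (by linarith) h1
      rw [Real.log_div hz0.ne' two_ne_zero, hlogz] at h2
      have : Real.log 2 ≤ 1 := by
        rw [Real.log_le_iff_le_exp two_pos]
        have := Real.exp_one_gt_d9; linarith
      have e : t / (2 * u ^ 2) = t / u ^ 2 - t / (2 * u ^ 2) := by ring
      have h3 : 1 ≤ t / (2 * u ^ 2) := by
        rw [le_div_iff₀ (by positivity)]; nlinarith only [hu2, htu, sq_nonneg u]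
      linarith only [h2, this, e, h3]
    have hsN : (Real.sqrt N)⁻¹ ≤ 20 ^ 10 / Real.log N ^ 10 :=
      FICancellation.inv_sqrt_le_div_log_pow (by linarith)
    have hN3 : 3 ≤ N := by omega
    have hlogN0 : 0 < Real.log N := Real.log_pos (by linarith)
    have hP₁ : ∏ p ∈ N.primesBelow, (1 + g p) ≤ K₃ * Real.log N := by
      have h := FICancellation.prod_primesBelow_one_add_mul_density_le hg0 h19' zero_le_one hN3
      simp only [one_mul] at h
      refine h.trans (le_of_eq ?_)
      rw [add_assoc, Real.exp_add, Real.exp_log hlogN0, hK₃, mul_comm]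
    have hP₈ : ∏ p ∈ N.primesBelow, (1 + 8 * g p) ≤ K₃ ^ 8 * Real.log N ^ 8 := by
      have h := FICancellation.prod_primesBelow_one_add_mul_density_le hg0 h19'
        (by norm_num : (0:ℝ) ≤ 8) hN3
      refine h.trans (le_of_eq ?_)
      rw [show (8 : ℝ) * (Real.log (Real.log N) + |c₁| + |K₂| / Real.log 2 ^ 10) =
        ((8 : ℕ) : ℝ) * (Real.log (Real.log N) + (|c₁| + |K₂| / Real.log 2 ^ 10)) by push_cast; ring,
        Real.exp_nat_mul, Real.exp_add, Real.exp_log hlogN0, hK₃, mul_pow, mul_comm]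
    have hP₈0 : 0 ≤ ∏ p ∈ N.primesBelow, (1 + 8 * g p) :=
      Finset.prod_nonneg fun p hp => by
        have := hg0 p (Nat.prime_of_mem_primesBelow hp); positivity
    -- `y ≥ 4`
    have hy4 : 4 ≤ y := by
      have ht4 : Real.log 4 ≤ t := by
        have h1 : Real.log 4 ≤ 4 - 1 := Real.log_le_sub_one_of_pos (by norm_num)
        have h2 : 3 * u ^ 2 ≤ t := by nlinarith only [hu2, htu, sq_nonneg u]
        linarith only [h1, h2, hu2]
      calc (4 : ℝ) = Real.exp (Real.log 4) := (Real.exp_log (by norm_num)).symm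
        _ ≤ Real.exp t := Real.exp_le_exp.mpr ht4
        _ = y := by rw [ht, Real.exp_log hy0]
    -- the structural bound and the numerics
    have hstruct := FICancellation.abs_sum_coprime_moebius_density_le hg hK₁0 h18' h19' h19f hc hC0
      hm hν hy4 hN8
    rw [ht] at htexp hlogN hlogN' hlogN1
    rw [hK₃] at hK₃1 hP₁ hP₈
    have hnum := FICancellation.numerics (Kf := Kf) (K₂ := K₂) hlarge htexp hK₃1 hC0 hc hK₁0 hσ1
      hlogN hlogN' hlogN1 (Real.sqrt_pos.mpr hN0) hsN hP₁ hP₈0 hP₈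
    refine (hstruct.trans hnum).trans ?_
    rw [← hK₃, mul_div_assoc, mul_div_assoc]
    exact mul_le_mul_of_nonneg_right (hKevle _) (by positivity)
  · ----------------------------------------------------------------
    -- small `y`: `log log y < 9`, so `t < e⁹` and the trivial bound suffices
    have ht9 : t ≤ Real.exp 9 := by
      have := not_le.mp hlarge
      rw [Real.log_lt_iff_lt_exp ht0] at this
      exact this.le
    refine htriv.trans ?_
    rw [← ht, le_div_iff₀ (by positivity)]
    have ht7 : t ^ 7 ≤ Real.exp 63 := by
      calc t ^ 7 ≤ Real.exp 9 ^ 7 := pow_le_pow_left₀ ht0.le ht9 7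
        _ = Real.exp 63 := by rw [← Real.exp_nat_mul]; norm_num
    calc K₃ * t * t ^ 6 = K₃ * t ^ 7 := by ring
      _ ≤ K₃ * Real.exp 63 := mul_le_mul_of_nonneg_left ht7 hK₃0
      _ ≤ K₃ * Real.exp 63 * sigmaHalf ν := le_mul_of_one_le_right (by positivity) hσ1
      _ ≤ max Kev (K₃ * Real.exp 63) * sigmaHalf ν :=
          mul_le_mul_of_nonneg_right (le_max_right _ _) (by linarith)

end Literature.NumberTheory.Sieve
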